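import Literature.MathematicalPhysics.QuantumFieldTheory.Balaban1983to89.T4FlagMemoryTwoRun

/-!
# `Balaban1983to89.T4TwoRunClosure` — node U2 / estimate NE4 by the TWO-RUN closure (technique P2) for β-families
generated by a one-step scheme: the FULL-β form (no one-loop split, no (AF-0r) binder, NO lower bound on β), the
comparison of the two closure WINDOWS of node U2, and node U2's output under ONE PRIMITIVE WINDOW
`8·cr·ℓ′·γ³ ≤ (1 − ν)²`.  Kernel bookkeeping over the hypothesis shapes of `T4FlagMemory` / `T4TwoRunMatching` and the
join `T4FlagMemoryTwoRun`; nothing about Bałaban's objects is asserted.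

HONEST FRAMING (cell `pub-balaban`, T4-DAG PAGE 1).  The cell's T4 target is rung (B)+1 of its ladder — existence AND
uniqueness of the ε → 0 limit of Bałaban's unit-scale expectations on a FIXED FINITE four-torus; NOT infinite volume,
NOT the Yang–Mills mass gap, NOT the Clay problem.  This module ASSERTS NOTHING about Bałaban's β-functions, effective
actions or renormalization transformations: the one-step scheme `Φ`, its read-out `r` and the four one-step shapes
`StepDirect` / `StepMemory` (+ `T4CouplingMatching.FadingMemory`) / `StepShift` / `ReadLipschitz` of `T4FlagMemory` §2
are HYPOTHESES, each NOT PRINTED (cell cross-reads `t4/T4-XREAD-U2.md` §3, `t4/T4-XREAD-U2R2.md` (N1)–(N4); GAPS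
G-t4-U2-1, G-t4-U2-2, G-t4-U2R-1…4, G-b12g6-1, G-b12g8-1, G-b12g8-2, G-ne4p1-1, G-ne4p2-1, G-ne4p2-2); the runs of the printed recursion (0.20)
in the box ]0,γ] and their infrared pin are BINDERS (node U1/H3 of the spine — conditional there on the (B)/(B^μ)
input; never constructed here); where the one-loop split is used, the β sub-cell's (AF-0r) rate is the BINDER `hconv`
(member of BetaPertH, NOT discharged for Bałaban's β).  Every theorem is elementary real-variable bookkeeping around the
imported fixed point `T4TwoRunMatching.twoPoint_fixedPoint` and the imported join `T4FlagMemoryTwoRun` §2.  Value =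
node U2's ledger for scheme-generated families with FEWER binders and ONE primitive window clause; NOT an estimate on
Bałaban's (2.13), NOT summit progress.

CITATION HEADER (lean-in-tree rule 2026-08-18).  T. Bałaban, *Renormalization group approach to lattice gauge field
theories. I*, Commun. Math. Phys. **109** (1987) 249–301 [Balaban1987RG1] (cell paper B12 = [I]; journal page = PDF
page + 248).  The manuscript is UNDER ADJUDICATION: quoted for what it STATES, never as establishing a disputed step.
NOTHING IS NEWLY QUOTED in this module.  The loci behind the hypothesis shapes — [I] p. 256 (0.20) "1/g_k² = 1/g²_{k+1}
+ β_{k+1}(g_k)" and (0.23) (the growing list of terms E^{(j)}), p. 264 (1.20)–(1.22) (β_{j+1} read off the new term by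
a fixed recipe), p. 268 (2.12)–(2.15) (the new term E^{(k+1)}(g_k, U_{k+1}) as a function of g_k and of the previous
action), p. 298 ("We write β_j as explicitly dependent on g_{j−1}, although it depends also on all preceding coupling
constants.") — are quoted VERBATIM, with the renders named, in the headers of the imported modules `T4FlagMemoryTwoRun`,
`T4FlagMemory` (lineage t4-ne4-p1), `T4TwoRunMatching` (this lineage) and `T4CouplingMatching` / `T4BetaMemory` below
them; the [cite:] tags below repeat those loci for the STRUCTURAL sentences they formalise and claim nothing more.

THE POINT (cell T4-DAG §2 U2 / §6 NE4; records `t4/T4-EST-NE4-P1.md`, `t4/T4-EST-NE4-P2.md`).  After the join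
`T4FlagMemoryTwoRun` (the four one-step inputs DELIVER technique P2's two located estimates `TwoRunRenewal` /
`TwoRunReadOut` along any two runs in the box), node U2 has two certified closures from ONE input list, whose remaining
conditionals differ: the box-uniform closure (`T4FlagMemory.injectedRate_of_scheme`, via
`T4CouplingMatching.injectedRate_of_runs_eventual`) needs an EVENTUAL LOWER BOUND `EventualLowerH b γ k₀ β` on the
β-functions and the asymptotic-freedom-weighted smallness `cr·ℓ′·((k₀+1)γ³ + 2γ/b) ≤ (1 − ρ)/2`; the two-run closure
(`T4FlagMemoryTwoRun.injectedRate_of_scheme_twoRun`, split form) needs neither, but the window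
`cr·ℓ′γ³·κ ≤ (1 − ρ)/2`, `κ = (ρ − ω)/(ρ − (1 + C′)ω)`.  `T4FlagMemoryTwoRun` leaves "which of the two windows the
spine should book" open.  THIS MODULE supplies the kernel facts that decide it for scheme-generated families:
* (§2) the FULL-β two-run closure `injectedRate_of_fullScheme_twoRun`: LITERALLY the conclusion of
  `T4FlagMemory.injectedRate_of_scheme` (same constant, same rate, same runs), from ITS hypothesis list with the four
  β-side binders {`0 < γ`, `0 < b`, `EventualLowerH b γ k₀ β`, `cr·ℓ′·((k₀+1)γ³ + 2γ/b) ≤ (1 − ρ)/2`} REPLACED by the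
  one window `cr·(ℓ′γ³)·κ ≤ (1 − ρ)/2` — and with no one-loop split and no (AF-0r) binder (with the full β read off the
  scheme, whatever makes β⁰ converge is inside the one-step source `StepShift`, exactly as in P1's theorem);
* (§3) `gain_of_afSmallness`: the box-uniform smallness IMPLIES the two-run window whenever `κ ≤ (k₀ + 1) + 2/(bγ²)` —
  in particular throughout the small-coupling regime — so on that regime the two-run closure has a sub-list of the
  box-uniform closure's hypotheses; and `gain_of_primitive`: ONE PRIMITIVE CLAUSE `8·cr·ℓ′·γ³ ≤ (1 − ν)²` on the
  scheme constants, for any `ν < 1` dominating the source rate θ and the memory threshold (1 + C′)ω, yields the memory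
  gap AND the window at the rate `ρ = (1 + ν)/2`; hence (`injectedRate_of_fullScheme_primitive`,
  `injectedRate_of_splitScheme_primitive`) node U2's output `T4CauchySum.InjectedRate` with EXPLICIT constant
  `8·cr·a/(1 − ν)²` (full form) resp. `8c₀/(1 − ν) + 8·cr·a/(1 − ν)²` (split form, (AF-0r) at a rate θ₀ ≤ ν), rate
  `(1 + ν)/2`, from the four one-step inputs, the runs, the pin and that clause ALONE;
* (§4) the hypotheses of the full closure are jointly satisfiable with genuinely non-zero memory and the STRICT gap
  `(1 + C′)ω < ρ` (`disc_le_linStep`, on `T4FlagMemory.linStep` with the identity read-out and the β-family it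
  generates; `T4FlagMemoryTwoRun.twoRunRenewal_linStep` sits at ρ = ω, outside the gap).
WHERE ASYMPTOTIC FREEDOM WENT: nowhere in the matching — only into the EXISTENCE of the pinned runs inside ]0,γ] (node
U1/H3, binders) and, as the size of γ ≥ the renormalized coupling, into the window clause (a smallness condition of
CUBIC order in γ).  WHAT DID NOT MOVE: the four one-step inputs and the memory threshold `(1 + C′)ω < 1` are exactly as
unprinted as before (`T4FlagMemory` §4/§6 locate them; `T4BetaMemorySharp.not_fadingMemory_below`: no rate below
(1 + C′)ω follows from the shapes).

## What is typed and proved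

(§1) READ-OUT OF ANY REPRESENTED FAMILY ALONG TWO RUNS: `generated` (the β-family a scheme generates; `represents_generated`),
`pairDist_eq_seqPairDist` (the join's majorant does not depend on the runs' lengths), `mismatch_le_of_represents` (for ANY
family `β′` represented by the scheme: |β′_{j+2}(g^B_0..g^B_{j+1}) − β′_{j+1}(g^A_0..g^A_j)| ≤ cr · pairDist_j),
`betaMismatch_le_of_represents` (full β).
(§2) THE FULL-β TWO-RUN CLOSURE: `disc_le_of_twoRun_full` (`twoPoint_fixedPoint` with the FULL mismatch read out,
p = 0), `injectedRate_of_fullScheme_twoRun`.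
(§3) WINDOWS: `gain_of_afSmallness`, `gain_of_primitive`, `injectedRate_mono_const`, `rateConst_le_primitive`,
`splitRateConst_le_primitive`, `injectedRate_of_fullScheme_primitive`, `injectedRate_of_splitScheme_primitive`.
(§4) NON-VACUITY WITH THE GAP: `disc_le_linStep`.

Deliberately NOT here: any instance of the one-step hypotheses for Bałaban's (2.13) (cell NE2/NE3/NE5/NE9 and the
memory constant — unprinted); the β⁰/(AF-0r) half itself (β sub-cell); the join (it is `T4FlagMemoryTwoRun`, lineage
t4-ne4-p1, imported BY NAME and restated nowhere).  NEW module of unit `b2b-balaban-t4-ne4-p2` generation 2 (planner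
seat, NE4 technique P2 "two-trajectory comparison"; journal claim T4-U2.NE4-PROVE-P2b*, CLAIMS.log 2026-08-19, scope
line 07:41Z); imports `T4FlagMemoryTwoRun` only (hence `T4FlagMemory`, `T4TwoRunMatching`, `T4CouplingMatching`,
`T4BetaMemory(Sharp)`, `FlowStep`, `B12Beta`, `T4CauchySum`) and modifies nothing; Mathlib otherwise; no `sorry`, no
`axiom`.  Companion record `t4/T4-EST-NE4-P2.md` v1.1 §7.
-/

namespace Literature.MathematicalPhysics.QuantumFieldTheory.Balaban1983to89.T4TwoRunClosure

open Literature.MathematicalPhysics.QuantumFieldTheory.Balaban1983to89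
open Literature.MathematicalPhysics.QuantumFieldTheory.Balaban1983to89.FlowStep
open Literature.MathematicalPhysics.QuantumFieldTheory.Balaban1983to89.T4CouplingMatching
open Literature.MathematicalPhysics.QuantumFieldTheory.Balaban1983to89.T4TwoRunMatching
open Literature.MathematicalPhysics.QuantumFieldTheory.Balaban1983to89.T4FlagMemory
open Literature.MathematicalPhysics.QuantumFieldTheory.Balaban1983to89.T4FlagMemoryTwoRun
open Finset

/-! ## §1 Read-out of any represented family along two runs -/

section Generated

variable {X : Type*} [Inhabited X]

/-- The β-family GENERATED by a one-step scheme `Φ` with read-out `r`: `β k (g_0..g_k) = r (entry born at k along the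
history)` — the structural content of (1.20)–(1.22)/(2.15) (β from the new term by a fixed recipe).  A family is
represented by the scheme (`Represents Φ r γ β`) iff it agrees with this one on the boxes. [cite: Balaban1987RG1, (2.15) p.268] -/
def generated (Φ : ℕ → ℝ → (ℕ → X) → X) (r : X → ℝ) : HBeta := fun k v => r (entry Φ (extd v) k)

/-- The generated family is represented (on every box). [folklore] -/
theorem represents_generated (Φ : ℕ → ℝ → (ℕ → X) → X) (r : X → ℝ) (γ : ℝ) : Represents Φ r γ (generated Φ r) :=
  fun _ _ _ => rfl

end Generated

section ReadOut

variable {X : Type*} [PseudoMetricSpace X] [Inhabited X]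

/-- The join's majorant `T4FlagMemoryTwoRun.pairDist Φ gA gB K j` (pair discrepancy along the CLAMPED runs) equals the
plain pair discrepancy `seqPairDist Φ gA gB j` for every matched pair `j ≤ K`: by prefix locality the clamping beyond
the runs' last scales is never read, so the data of technique P2's two located shapes do not depend on K. [folklore] -/
theorem pairDist_eq_seqPairDist (Φ : ℕ → ℝ → (ℕ → X) → X) (gA gB : ℕ → ℝ) {K j : ℕ} (hj : j ≤ K) :
    pairDist Φ gA gB K j = seqPairDist Φ gA gB j := by
  unfold pairDist seqPairDist
  rw [entry_congr Φ (g := extd (prefixOf gB (K + 1))) (g' := gB) (j := j + 1)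
      (fun m hm => extd_prefixOf (hm.trans (Nat.succ_le_succ hj))),
    entry_congr Φ (g := extd (prefixOf gA K)) (g' := gA) (j := j) (fun m hm => extd_prefixOf (hm.trans hj))]

/-- **READ-OUT OF ANY REPRESENTED FAMILY.**  If a β-family `β′` (the full β, the remainder β¹ of the one-loop split, …)
is read off the scheme on the boxes (`Represents Φ r γ β′`) with `ReadLipschitz r cr`, then for run A in the box up to K
and run B up to K + 1 and every matched pair `j < K`:
`|β′_{j+2}(g^B_0..g^B_{j+1}) − β′_{j+1}(g^A_0..g^A_j)| ≤ cr · pairDist_j`.  `T4FlagMemoryTwoRun.twoRunReadOut_of_scheme`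
is the instance `β′ = S.β1`; `betaMismatch_le_of_represents` below the instance `β′ = β`.  Printed basis of the shape:
β is read off the NEW term by the fixed recipe (1.20)/(1.22); the constant `cr` and the norm are NOT PRINTED.
[cite: Balaban1987RG1, (1.20)-(1.22) p.264 and (2.15) p.268] -/
theorem mismatch_le_of_represents {Φ : ℕ → ℝ → (ℕ → X) → X} {r : X → ℝ} {β' : HBeta} {γ cr : ℝ} {K : ℕ}
    {gA gB : ℕ → ℝ} (hrep : Represents Φ r γ β') (hr : ReadLipschitz r cr)
    (hAbox : ∀ i, i ≤ K → 0 < gA i ∧ gA i ≤ γ) (hBbox : ∀ i, i ≤ K + 1 → 0 < gB i ∧ gB i ≤ γ) {j : ℕ} (hj : j < K) :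
    |β' (j + 1) (prefixOf gB (j + 1)) - β' j (prefixOf gA j)| ≤ cr * pairDist Φ gA gB K j := by
  unfold pairDist seqPairDist
  rw [hrep (j + 1) _ (prefixOf_mem_box (show j + 1 ≤ K + 1 by omega) hBbox),
    hrep j _ (prefixOf_mem_box hj.le hAbox),
    entry_extd_prefixOf Φ gB (show j + 1 ≤ K + 1 by omega), entry_extd_prefixOf Φ gA hj.le]
  exact hr _ _

/-- Consistency with the join: `T4FlagMemoryTwoRun.twoRunReadOut_of_scheme` is the instance `β′ = S.β1`. [folklore] -/
example {β : HBeta} (S : B12Beta.OneLoopSplit β) {Φ : ℕ → ℝ → (ℕ → X) → X} {r : X → ℝ} {γ cr : ℝ} {K : ℕ}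
    {gA gB : ℕ → ℝ} (hrep : Represents Φ r γ S.β1) (hr : ReadLipschitz r cr)
    (hAbox : ∀ i, i ≤ K → 0 < gA i ∧ gA i ≤ γ) (hBbox : ∀ i, i ≤ K + 1 → 0 < gB i ∧ gB i ≤ γ) :
    TwoRunReadOut S cr gA gB (pairDist Φ gA gB K) K := fun _ hj =>
  mismatch_le_of_represents hrep hr hAbox hBbox hj

/-- The instance `β′ = β` (FULL β read off the scheme): the full two-run β-mismatch
`T4TwoRunMatching.betaMismatch β gA gB j ≤ cr · pairDist_j` for `j < K`; then no one-loop split and no (AF-0r) enter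
the read-out (§2). [cite: Balaban1987RG1, (1.20)-(1.22) p.264] -/
theorem betaMismatch_le_of_represents {β : HBeta} {Φ : ℕ → ℝ → (ℕ → X) → X} {r : X → ℝ} {γ cr : ℝ} {K : ℕ}
    {gA gB : ℕ → ℝ} (hrep : Represents Φ r γ β) (hr : ReadLipschitz r cr)
    (hAbox : ∀ i, i ≤ K → 0 < gA i ∧ gA i ≤ γ) (hBbox : ∀ i, i ≤ K + 1 → 0 < gB i ∧ gB i ≤ γ) :
    ∀ j, j < K → betaMismatch β gA gB j ≤ cr * pairDist Φ gA gB K j := fun _ hj =>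
  mismatch_le_of_represents hrep hr hAbox hBbox hj

end ReadOut

/-! ## §2 The full-β two-run closure -/

section Full

variable {X : Type*} [PseudoMetricSpace X] [Inhabited X]

/-- **THE TWO-POINT SYSTEM WITH THE FULL MISMATCH READ OUT** (`T4TwoRunMatching.twoPoint_fixedPoint` with `p = 0`): two
pinned runs of (0.20) in the box, a read-out `betaMismatch β gA gB j ≤ q·s_j` of the FULL two-run β-mismatch, the
two-run renewal `TwoRunRenewal a ℓ′ ρ M gA gB s K` with `FadingMemory C ω M`, the gap `(1 + C)ω < ρ < 1` and the window
`q·(ℓ′γ³)·κ ≤ (1 − ρ)/2`, `κ = (ρ − ω)/(ρ − (1 + C)ω)`, give `disc gA gB j ≤ 2qaκ(1 − ρ)⁻¹ρ^j` (j ≤ K) and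
`s_j ≤ (a + ℓ′γ³·2qaκ(1 − ρ)⁻¹)κρ^j` (j < K).  No one-loop split, no (AF-0r): whatever makes β⁰ converge is inside the
source `a` of `s`.  (`T4TwoRunMatching.disc_le_of_twoRun` is the split form, p = 2c₀.) [folklore] -/
theorem disc_le_of_twoRun_full {β : HBeta} {K : ℕ} {gA gB s : ℕ → ℝ} {M : ℕ → ℕ → ℝ} {γ a ℓ' q C ω ρ : ℝ}
    (hρ1 : ρ < 1) (hω : 0 ≤ ω) (hC : 0 ≤ C) (hsmall : (1 + C) * ω < ρ)
    (ha : 0 ≤ a) (hℓ' : 0 ≤ ℓ') (hq : 0 ≤ q)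
    (hA : RGEqH K β gA) (hB : RGEqH (K + 1) β gB)
    (hAbox : ∀ i, i ≤ K → 0 < gA i ∧ gA i ≤ γ) (hBbox : ∀ i, i ≤ K + 1 → 0 < gB i ∧ gB i ≤ γ)
    (hpin : gA K = gB (K + 1))
    (hread : ∀ j, j < K → betaMismatch β gA gB j ≤ q * s j)
    (hren : TwoRunRenewal a ℓ' ρ M gA gB s K) (hs : ∀ j, j < K → 0 ≤ s j) (hM : FadingMemory C ω M)
    (hgain : q * (ℓ' * γ ^ 3) * ((ρ - ω) / (ρ - (1 + C) * ω)) ≤ (1 - ρ) / 2) :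
    (∀ j, j ≤ K → disc gA gB j ≤ 2 * (q * a * ((ρ - ω) / (ρ - (1 + C) * ω))) / (1 - ρ) * ρ ^ j) ∧
    (∀ j, j < K → s j ≤ (a + ℓ' * γ ^ 3 * (2 * (q * a * ((ρ - ω) / (ρ - (1 + C) * ω))) / (1 - ρ)))
      * ((ρ - ω) / (ρ - (1 + C) * ω)) * ρ ^ j) := by
  have hu : ∀ j, j < K →
      0 ≤ ℓ' * ((gA j) ^ 2 * gB (j + 1)) ∧ ℓ' * ((gA j) ^ 2 * gB (j + 1)) ≤ ℓ' * γ ^ 3 := by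
    intro j hj
    have hgA := hAbox j hj.le
    have hgB := hBbox (j + 1) (by omega)
    have hcube : (gA j) ^ 2 * gB (j + 1) ≤ γ ^ 3 := by
      calc (gA j) ^ 2 * gB (j + 1) ≤ γ ^ 2 * γ :=
            mul_le_mul (pow_le_pow_left₀ hgA.1.le hgA.2 2) hgB.2 hgB.1.le (sq_nonneg γ)
        _ = γ ^ 3 := by ring
    exact ⟨mul_nonneg hℓ' (mul_nonneg (sq_nonneg _) hgB.1.le), mul_le_mul_of_nonneg_left hcube hℓ'⟩
  have hγ : 0 < γ := lt_of_lt_of_le (hAbox 0 (Nat.zero_le K)).1 (hAbox 0 (Nat.zero_le K)).2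
  have hback : ∀ j, j < K → disc gA gB j ≤ disc gA gB (j + 1) + 0 * ρ ^ j + q * s j := by
    intro j hj
    have h1 := disc_step_twoRun hA hB hj
    have h3 := hread j hj
    rw [zero_mul, add_zero]
    linarith
  have hfwd : ∀ j, j < K →
      s j ≤ a * ρ ^ j + ℓ' * ((gA j) ^ 2 * gB (j + 1)) * disc gA gB j + ∑ i ∈ range j, M j i * s i := by
    intro j hj
    have h1 := hren j hj
    have hgA := hAbox j hj.le
    have hgB := hBbox (j + 1) (by omega)
    have h2 : ℓ' * |gA j - gB (j + 1)| ≤ ℓ' * ((gA j) ^ 2 * gB (j + 1)) * disc gA gB j := by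
      rw [mul_assoc]
      exact mul_le_mul_of_nonneg_left (abs_sub_le_of_inv_sq hgA.1 hgB.1) hℓ'
    linarith
  have h := twoPoint_fixedPoint (δ := disc gA gB) (e := fun j => ℓ' * ((gA j) ^ 2 * gB (j + 1)))
    (ē := ℓ' * γ ^ 3) (p := 0) (q := q)
    hρ1 hω hC hsmall ha le_rfl hq (by positivity) (disc_nonneg gA gB) hs hu
    (fun j i hij => hM j i hij.le) (disc_pin hpin) hback hfwd hgain
  simp only [zero_add] at h
  exact h

/-- **NODE U2's OUTPUT FOR A β-FAMILY GENERATED BY A ONE-STEP SCHEME — THE CONCLUSION OF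
`T4FlagMemory.injectedRate_of_scheme`, LITERALLY (same constant `2·cr·(a(ρ−ω)/(ρ−(1+C′)ω))/(1−ρ)`, same rate, same
runs), FROM ITS HYPOTHESIS LIST WITH THE β-SIDE BINDERS {`0 < γ`, `0 < b`, `EventualLowerH b γ k₀ β`,
`cr·ℓ′·((k₀+1)γ³ + 2γ/b) ≤ (1 − ρ)/2`} REPLACED BY THE ONE WINDOW `cr·(ℓ′γ³)·κ ≤ (1 − ρ)/2`.**  The remaining
hypotheses — `Represents Φ r γ β` (FULL β; no split, no (AF-0r)), `ReadLipschitz r cr`, `StepDirect Φ ℓ′ γ`,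
`StepMemory Φ M′` with `FadingMemory C′ ω M′`, `StepShift Φ γ src` with `src k ≤ aρ^k`, `(1 + C′)ω < ρ < 1`, the printed
recursion (0.20) for every run of the family, the box, the pin — are P1's verbatim.  Proof: the join
(`T4FlagMemoryTwoRun.twoRunRenewal_of_scheme`, §1) and `disc_le_of_twoRun_full`.  Bookkeeping over UNPRINTED inputs;
NOT summit progress. [cite: Balaban1987RG1, (0.20) p.256 and Thm 2 p.259] -/
theorem injectedRate_of_fullScheme_twoRun {β : HBeta} {Φ : ℕ → ℝ → (ℕ → X) → X} {r : X → ℝ} {M' : ℕ → ℕ → ℝ}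
    {src : ℕ → ℝ} (g : ℕ → ℕ → ℝ) (gIR : ℝ) {ℓ' C' ω γ cr a ρ : ℝ}
    (hρ1 : ρ < 1) (hℓ' : 0 ≤ ℓ') (hC' : 0 ≤ C') (hω : 0 ≤ ω) (hcr : 0 ≤ cr) (ha : 0 ≤ a)
    (hsmall : (1 + C') * ω < ρ)
    (hrep : Represents Φ r γ β) (hr : ReadLipschitz r cr) (hdir : StepDirect Φ ℓ' γ)
    (hmem : StepMemory Φ M') (hM' : FadingMemory C' ω M') (hsh : StepShift Φ γ src)
    (hsrc : ∀ k, src k ≤ a * ρ ^ k)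
    (hrun : ∀ K, RGEqH K β (g K)) (hbox : ∀ K i, i ≤ K → 0 < g K i ∧ g K i ≤ γ)
    (hpin : ∀ K, g K K = gIR)
    (hgain : cr * (ℓ' * γ ^ 3) * ((ρ - ω) / (ρ - (1 + C') * ω)) ≤ (1 - ρ) / 2) :
    T4CauchySum.InjectedRate (2 * (cr * (a * (ρ - ω) / (ρ - (1 + C') * ω))) / (1 - ρ)) 0 ρ
      (fun K j => disc (g K) (g (K + 1)) j) := by
  intro K j hj
  refine ⟨disc_nonneg _ _ _, ?_⟩
  have h := (disc_le_of_twoRun_full hρ1 hω hC' hsmall ha hℓ' hcr (hrun K) (hrun (K + 1)) (hbox K) (hbox (K + 1))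
    ((hpin K).trans (hpin (K + 1)).symm)
    (betaMismatch_le_of_represents hrep hr (hbox K) (hbox (K + 1)))
    (twoRunRenewal_of_scheme hdir hmem hsh hsrc (hbox K) (hbox (K + 1)))
    (fun j _ => pairDist_nonneg Φ (g K) (g (K + 1)) K j) hM' hgain).1 j hj
  have h' : disc (g K) (g (K + 1)) j ≤ 2 * (cr * (a * (ρ - ω) / (ρ - (1 + C') * ω))) / (1 - ρ) * ρ ^ j :=
    calc disc (g K) (g (K + 1)) j ≤ 2 * (cr * a * ((ρ - ω) / (ρ - (1 + C') * ω))) / (1 - ρ) * ρ ^ j := h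
      _ = 2 * (cr * (a * (ρ - ω) / (ρ - (1 + C') * ω))) / (1 - ρ) * ρ ^ j := by ring
  simpa using h'

end Full

/-! ## §3 The two windows of node U2 compared, and one primitive window -/

section Windows

/-- WHEN THE BOX-UNIFORM SMALLNESS IMPLIES THE TWO-RUN WINDOW: if `κ ≤ (k₀ + 1) + 2/(bγ²)` (`γ, b > 0`; always so in
the small-coupling regime `2/(bγ²) ≥ κ − 1`), then `cr·ℓ′·((k₀+1)γ³ + 2γ/b) ≤ (1 − ρ)/2` implies
`cr·(ℓ′γ³)·κ ≤ (1 − ρ)/2`.  So on that regime the hypotheses of `injectedRate_of_fullScheme_twoRun` are a SUB-LIST of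
those of `T4FlagMemory.injectedRate_of_scheme` (the lower bound `EventualLowerH` is simply dropped).  Conversely
nothing: κ ≥ 1, and the box-uniform closure needs the lower bound whatever the window. [folklore] -/
theorem gain_of_afSmallness {cr ℓ' γ b ρ κ : ℝ} {k₀ : ℕ} (hγ : 0 < γ) (hb : 0 < b) (hcr : 0 ≤ cr) (hℓ' : 0 ≤ ℓ')
    (hκ : κ ≤ ((k₀ : ℝ) + 1) + 2 / (b * γ ^ 2))
    (hsmall₂ : cr * ℓ' * (((k₀ : ℝ) + 1) * γ ^ 3 + 2 * γ / b) ≤ (1 - ρ) / 2) :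
    cr * (ℓ' * γ ^ 3) * κ ≤ (1 - ρ) / 2 := by
  have h0 : 0 ≤ cr * (ℓ' * γ ^ 3) := by positivity
  have hb' : b ≠ 0 := hb.ne'
  have hγ' : γ ≠ 0 := hγ.ne'
  have e : cr * (ℓ' * γ ^ 3) * (((k₀ : ℝ) + 1) + 2 / (b * γ ^ 2))
      = cr * ℓ' * (((k₀ : ℝ) + 1) * γ ^ 3 + 2 * γ / b) := by
    field_simp
  calc cr * (ℓ' * γ ^ 3) * κ ≤ cr * (ℓ' * γ ^ 3) * (((k₀ : ℝ) + 1) + 2 / (b * γ ^ 2)) :=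
        mul_le_mul_of_nonneg_left hκ h0
    _ = cr * ℓ' * (((k₀ : ℝ) + 1) * γ ^ 3 + 2 * γ / b) := e
    _ ≤ (1 - ρ) / 2 := hsmall₂

/-- **ONE PRIMITIVE WINDOW.**  For scheme constants `cr, ℓ′ ≥ 0`, a box bound `γ ≥ 0`, memory parameters `C′, ω ≥ 0`
and any `ν < 1` with `(1 + C′)ω ≤ ν`, the clause `8·cr·ℓ′·γ³ ≤ (1 − ν)²` gives, at the rate `ρ := (1 + ν)/2`: the memory
gap `(1 + C′)ω < ρ`, `ρ < 1`, and the two-run window `cr·(ℓ′γ³)·(ρ − ω)/(ρ − (1 + C′)ω) ≤ (1 − ρ)/2` (since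
`ρ − (1 + C′)ω ≥ (1 − ν)/2` and `ρ − ω ≤ 1`).  Pure arithmetic. [folklore] -/
theorem gain_of_primitive {cr ℓ' γ ν C' ω : ℝ} (hcr : 0 ≤ cr) (hℓ' : 0 ≤ ℓ') (hγ : 0 ≤ γ) (hC' : 0 ≤ C')
    (hω : 0 ≤ ω) (hν1 : ν < 1) (hCων : (1 + C') * ω ≤ ν) (hprim : 8 * cr * ℓ' * γ ^ 3 ≤ (1 - ν) ^ 2) :
    (1 + C') * ω < (1 + ν) / 2 ∧ (1 + ν) / 2 < 1 ∧
    cr * (ℓ' * γ ^ 3) * (((1 + ν) / 2 - ω) / ((1 + ν) / 2 - (1 + C') * ω)) ≤ (1 - (1 + ν) / 2) / 2 := by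
  have hCω : 0 ≤ C' * ω := mul_nonneg hC' hω
  have hden : 0 < (1 + ν) / 2 - (1 + C') * ω := by linarith
  have ht : 0 ≤ cr * (ℓ' * γ ^ 3) := by positivity
  refine ⟨by linarith, by linarith, ?_⟩
  rw [← mul_div_assoc, div_le_iff₀ hden]
  have hnum1 : (1 + ν) / 2 - ω ≤ 1 := by linarith
  have h1 : cr * (ℓ' * γ ^ 3) * ((1 + ν) / 2 - ω) ≤ cr * (ℓ' * γ ^ 3) := by
    calc cr * (ℓ' * γ ^ 3) * ((1 + ν) / 2 - ω) ≤ cr * (ℓ' * γ ^ 3) * 1 := mul_le_mul_of_nonneg_left hnum1 ht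
      _ = cr * (ℓ' * γ ^ 3) := mul_one _
  have h2 : (1 - ν) / 2 ≤ (1 + ν) / 2 - (1 + C') * ω := by linarith
  have h3 : (1 - ν) / 4 * ((1 - ν) / 2) ≤ (1 - (1 + ν) / 2) / 2 * ((1 + ν) / 2 - (1 + C') * ω) := by
    have e : (1 - (1 + ν) / 2) / 2 = (1 - ν) / 4 := by ring
    rw [e]
    exact mul_le_mul_of_nonneg_left h2 (by linarith)
  have h4 : cr * (ℓ' * γ ^ 3) ≤ (1 - ν) / 4 * ((1 - ν) / 2) := by nlinarith [hprim]
  linarith [h1, h3, h4]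

/-- `T4CauchySum.InjectedRate` is monotone in its constant (for a nonnegative rate). [folklore] -/
theorem injectedRate_mono_const {C₁ C₂ θ : ℝ} {c : ℕ} {inj : ℕ → ℕ → ℝ} (h : T4CauchySum.InjectedRate C₁ c θ inj)
    (hC : C₁ ≤ C₂) (hθ : 0 ≤ θ) : T4CauchySum.InjectedRate C₂ c θ inj := fun K j hj =>
  ⟨(h K j hj).1, (h K j hj).2.trans
    (mul_le_mul_of_nonneg_right (mul_le_mul_of_nonneg_right hC (by positivity)) (pow_nonneg hθ j))⟩

/-- The full-form output constant at the rate `ρ = (1 + ν)/2` is at most `8·cr·a/(1 − ν)²`. [folklore] -/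
theorem rateConst_le_primitive {cr a ν C' ω : ℝ} (hcr : 0 ≤ cr) (ha : 0 ≤ a) (hC' : 0 ≤ C') (hω : 0 ≤ ω)
    (hν1 : ν < 1) (hCων : (1 + C') * ω ≤ ν) :
    2 * (cr * (a * ((1 + ν) / 2 - ω) / ((1 + ν) / 2 - (1 + C') * ω))) / (1 - (1 + ν) / 2)
      ≤ 8 * cr * a / (1 - ν) ^ 2 := by
  have hCω : 0 ≤ C' * ω := mul_nonneg hC' hω
  have hden : 0 < (1 + ν) / 2 - (1 + C') * ω := by linarith
  have h1ν : 0 < 1 - ν := by linarith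
  set F : ℝ := ((1 + ν) / 2 - ω) / ((1 + ν) / 2 - (1 + C') * ω) with hF
  have hF2 : F * (1 - ν) ≤ 2 := by
    rw [hF, div_mul_eq_mul_div, div_le_iff₀ hden]
    have hnum1 : (1 + ν) / 2 - ω ≤ 1 := by linarith
    have := mul_le_mul_of_nonneg_right hnum1 h1ν.le
    linarith
  have e1 : 2 * (cr * (a * ((1 + ν) / 2 - ω) / ((1 + ν) / 2 - (1 + C') * ω))) / (1 - (1 + ν) / 2)
      = 4 * cr * a * F / (1 - ν) := by
    have e0 : 1 - (1 + ν) / 2 = (1 - ν) / 2 := by ring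
    rw [e0, hF, div_div_eq_mul_div]
    ring
  rw [e1, div_le_div_iff₀ h1ν (pow_pos h1ν 2)]
  have hca : 0 ≤ 4 * cr * a * (1 - ν) := by positivity
  have := mul_le_mul_of_nonneg_left hF2 hca
  nlinarith [this]

/-- The split-form output constant (`T4FlagMemoryTwoRun.injectedRate_of_scheme_twoRun`) at the rate `ρ = (1 + ν)/2` is
at most `8c₀/(1 − ν) + 8·cr·a/(1 − ν)²`. [folklore] -/
theorem splitRateConst_le_primitive {c₀ cr a ν C' ω : ℝ} (hcr : 0 ≤ cr) (ha : 0 ≤ a) (hC' : 0 ≤ C')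
    (hω : 0 ≤ ω) (hν1 : ν < 1) (hCων : (1 + C') * ω ≤ ν) :
    2 * (2 * c₀ + cr * a * (((1 + ν) / 2 - ω) / ((1 + ν) / 2 - (1 + C') * ω))) / (1 - (1 + ν) / 2)
      ≤ 8 * c₀ / (1 - ν) + 8 * cr * a / (1 - ν) ^ 2 := by
  have hCω : 0 ≤ C' * ω := mul_nonneg hC' hω
  have h1ν : 0 < 1 - ν := by linarith
  have e0 : 1 - (1 + ν) / 2 = (1 - ν) / 2 := by ring
  have hsplit : 2 * (2 * c₀ + cr * a * (((1 + ν) / 2 - ω) / ((1 + ν) / 2 - (1 + C') * ω))) / (1 - (1 + ν) / 2)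
      = 8 * c₀ / (1 - ν)
        + 2 * (cr * (a * ((1 + ν) / 2 - ω) / ((1 + ν) / 2 - (1 + C') * ω))) / (1 - (1 + ν) / 2) := by
    rw [e0, div_div_eq_mul_div, div_div_eq_mul_div]
    ring
  rw [hsplit]
  exact add_le_add le_rfl (rateConst_le_primitive hcr ha hC' hω hν1 hCων)

variable {X : Type*} [PseudoMetricSpace X] [Inhabited X]

/-- **NODE U2's OUTPUT UNDER THE ONE PRIMITIVE WINDOW (full-β form).**  A scheme representing the FULL β with
`ReadLipschitz r cr`, `StepDirect Φ ℓ′ γ`, `StepMemory Φ M′` + `FadingMemory C′ ω M′`, `StepShift Φ γ src` with a source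
rate `src k ≤ aθ^k`; ONE number `ν < 1` dominating `θ` and the memory threshold `(1 + C′)ω`; the family of pinned runs
of (0.20) in the box ]0,γ] (node U1/H3 — binders); and the clause `8·cr·ℓ′·γ³ ≤ (1 − ν)²`.  THEN
`T4CauchySum.InjectedRate (8·cr·a/(1 − ν)²) 0 ((1 + ν)/2) (fun K j ↦ disc (g K) (g (K+1)) j)` — nodes U4/U5's input
with explicit constant and rate.  (`gain_of_primitive` + `injectedRate_of_fullScheme_twoRun` + `rateConst_le_primitive`.)
Every analytic input is a HYPOTHESIS SHAPE (NOT PRINTED); bookkeeping only; NOT summit progress.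
[cite: Balaban1987RG1, (0.20) p.256 and Thm 2 p.259] -/
theorem injectedRate_of_fullScheme_primitive {β : HBeta} {Φ : ℕ → ℝ → (ℕ → X) → X} {r : X → ℝ} {M' : ℕ → ℕ → ℝ}
    {src : ℕ → ℝ} (g : ℕ → ℕ → ℝ) (gIR : ℝ) {ℓ' C' ω γ cr a θ ν : ℝ}
    (hℓ' : 0 ≤ ℓ') (hC' : 0 ≤ C') (hω : 0 ≤ ω) (hcr : 0 ≤ cr) (ha : 0 ≤ a) (hθ : 0 ≤ θ)
    (hν1 : ν < 1) (hθν : θ ≤ ν) (hCων : (1 + C') * ω ≤ ν)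
    (hrep : Represents Φ r γ β) (hr : ReadLipschitz r cr) (hdir : StepDirect Φ ℓ' γ)
    (hmem : StepMemory Φ M') (hM' : FadingMemory C' ω M') (hsh : StepShift Φ γ src)
    (hsrc : ∀ k, src k ≤ a * θ ^ k)
    (hrun : ∀ K, RGEqH K β (g K)) (hbox : ∀ K i, i ≤ K → 0 < g K i ∧ g K i ≤ γ)
    (hpin : ∀ K, g K K = gIR)
    (hprim : 8 * cr * ℓ' * γ ^ 3 ≤ (1 - ν) ^ 2) :
    T4CauchySum.InjectedRate (8 * cr * a / (1 - ν) ^ 2) 0 ((1 + ν) / 2) (fun K j => disc (g K) (g (K + 1)) j) := by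
  have hγ : 0 ≤ γ := ((hbox 0 0 le_rfl).1.le).trans (hbox 0 0 le_rfl).2
  obtain ⟨hgap, hρ1, hgain⟩ := gain_of_primitive hcr hℓ' hγ hC' hω hν1 hCων hprim
  have hρ0 : 0 ≤ (1 + ν) / 2 := by
    have : 0 ≤ (1 + C') * ω := mul_nonneg (by linarith) hω
    linarith
  have hsrc' : ∀ k, src k ≤ a * ((1 + ν) / 2) ^ k := fun k =>
    (hsrc k).trans (mul_le_mul_of_nonneg_left (pow_le_pow_left₀ hθ (by linarith) k) ha)
  exact injectedRate_mono_const
    (injectedRate_of_fullScheme_twoRun g gIR hρ1 hℓ' hC' hω hcr ha hgap hrep hr hdir hmem hM' hsh hsrc' hrun hbox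
      hpin hgain)
    (rateConst_le_primitive hcr ha hC' hω hν1 hCων) hρ0

/-- **NODE U2's OUTPUT UNDER THE ONE PRIMITIVE WINDOW (split form — the cell's booking: β = β⁰ + β¹ with (AF-0r) from
the β sub-cell).**  A scheme representing the REMAINDER `S.β1` of the printed one-loop split with the four one-step
shapes (source rate θ), (AF-0r) `|β⁰_{k+1} − β∞| ≤ c₀θ₀^k` (binder `hconv`; BetaPertH, NOT discharged), ONE number
`ν < 1` dominating `θ`, `θ₀` and `(1 + C′)ω`, the pinned runs in the box (binders), and the clause
`8·cr·ℓ′·γ³ ≤ (1 − ν)²`: then `T4CauchySum.InjectedRate (8c₀/(1 − ν) + 8·cr·a/(1 − ν)²) 0 ((1 + ν)/2) (fun K j ↦ disc …)`.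
(`gain_of_primitive` + `T4FlagMemoryTwoRun.injectedRate_of_scheme_twoRun` + `splitRateConst_le_primitive`.)  Bookkeeping
over UNPRINTED inputs; NOT summit progress. [cite: Balaban1987RG1, (0.20) p.256 and (2.12)-(2.14) p.268] -/
theorem injectedRate_of_splitScheme_primitive {β : HBeta} (S : B12Beta.OneLoopSplit β) {Φ : ℕ → ℝ → (ℕ → X) → X}
    {r : X → ℝ} {M' : ℕ → ℕ → ℝ} {src : ℕ → ℝ} (g : ℕ → ℕ → ℝ) (gIR : ℝ) {ℓ' C' ω γ cr a θ θ₀ ν binf c₀ : ℝ}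
    (hℓ' : 0 ≤ ℓ') (hC' : 0 ≤ C') (hω : 0 ≤ ω) (hcr : 0 ≤ cr) (ha : 0 ≤ a) (hc₀ : 0 ≤ c₀) (hθ : 0 ≤ θ)
    (hθ₀ : 0 ≤ θ₀) (hν1 : ν < 1) (hθν : θ ≤ ν) (hθ₀ν : θ₀ ≤ ν) (hCων : (1 + C') * ω ≤ ν)
    (hconv : ∀ k, |S.β0 k - binf| ≤ c₀ * θ₀ ^ k)
    (hrep : Represents Φ r γ S.β1) (hr : ReadLipschitz r cr) (hdir : StepDirect Φ ℓ' γ)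
    (hmem : StepMemory Φ M') (hM' : FadingMemory C' ω M') (hsh : StepShift Φ γ src)
    (hsrc : ∀ k, src k ≤ a * θ ^ k)
    (hrun : ∀ K, RGEqH K β (g K)) (hbox : ∀ K i, i ≤ K → 0 < g K i ∧ g K i ≤ γ)
    (hpin : ∀ K, g K K = gIR)
    (hprim : 8 * cr * ℓ' * γ ^ 3 ≤ (1 - ν) ^ 2) :
    T4CauchySum.InjectedRate (8 * c₀ / (1 - ν) + 8 * cr * a / (1 - ν) ^ 2) 0 ((1 + ν) / 2)
      (fun K j => disc (g K) (g (K + 1)) j) := by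
  have hγ : 0 ≤ γ := ((hbox 0 0 le_rfl).1.le).trans (hbox 0 0 le_rfl).2
  obtain ⟨hgap, hρ1, hgain⟩ := gain_of_primitive hcr hℓ' hγ hC' hω hν1 hCων hprim
  have hρ0 : 0 ≤ (1 + ν) / 2 := by
    have : 0 ≤ (1 + C') * ω := mul_nonneg (by linarith) hω
    linarith
  have hsrc' : ∀ k, src k ≤ a * ((1 + ν) / 2) ^ k := fun k =>
    (hsrc k).trans (mul_le_mul_of_nonneg_left (pow_le_pow_left₀ hθ (by linarith) k) ha)
  have hconv' : ∀ k, |S.β0 k - binf| ≤ c₀ * ((1 + ν) / 2) ^ k := fun k =>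
    (hconv k).trans (mul_le_mul_of_nonneg_left (pow_le_pow_left₀ hθ₀ (by linarith) k) hc₀)
  exact injectedRate_mono_const
    (injectedRate_of_scheme_twoRun S g gIR hρ1 hω hC' hgap hc₀ ha hℓ' hcr hrep hr hdir hmem hM' hsh hsrc' hrun hbox
      hpin hconv' hgain)
    (splitRateConst_le_primitive hcr ha hC' hω hν1 hCων) hρ0

end Windows

/-! ## §4 Non-vacuity with the strict memory gap -/

section Witness

/-- NON-VACUITY OF THE FULL CLOSURE's HYPOTHESIS SET, GIVEN THE RUNS [folklore]: `T4FlagMemory`'s linear witness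
`linStep ℓ′ C′ ω` on `X = ℝ` with the identity read-out satisfies the four shapes with source `(C′ℓ′γω)·ω^k`
(`linStep_direct/memory/fading/shift`, `readLipschitz_id`) — genuinely non-zero memory — and for the β-family it
GENERATES, any two pinned runs of (0.20) in the box, any rate ρ in the STRICT gap `(1 + C′)ω < ρ < 1` (the source rate
ω being worsened to ρ) and the window `1·(ℓ′γ³)·κ ≤ (1 − ρ)/2` give the matching rate `2·(C′ℓ′γω)·κ(1 − ρ)⁻¹ρ^j`.
(`T4FlagMemoryTwoRun.twoRunRenewal_linStep` is the renewal at ρ = ω, outside the gap.) [folklore] -/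
theorem disc_le_linStep {K : ℕ} {gA gB : ℕ → ℝ} {ℓ' C' ω γ ρ : ℝ}
    (hℓ' : 0 ≤ ℓ') (hC' : 0 ≤ C') (hω : 0 ≤ ω) (hρ1 : ρ < 1) (hsmall : (1 + C') * ω < ρ)
    (hA : RGEqH K (generated (linStep ℓ' C' ω) (fun x : ℝ => x)) gA)
    (hB : RGEqH (K + 1) (generated (linStep ℓ' C' ω) (fun x : ℝ => x)) gB)
    (hAbox : ∀ i, i ≤ K → 0 < gA i ∧ gA i ≤ γ) (hBbox : ∀ i, i ≤ K + 1 → 0 < gB i ∧ gB i ≤ γ)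
    (hpin : gA K = gB (K + 1))
    (hgain : 1 * (ℓ' * γ ^ 3) * ((ρ - ω) / (ρ - (1 + C') * ω)) ≤ (1 - ρ) / 2) :
    ∀ j, j ≤ K → disc gA gB j
      ≤ 2 * (1 * (C' * ℓ' * γ * ω) * ((ρ - ω) / (ρ - (1 + C') * ω))) / (1 - ρ) * ρ ^ j := by
  have hγ : 0 ≤ γ := ((hAbox 0 (Nat.zero_le K)).1.le).trans (hAbox 0 (Nat.zero_le K)).2
  have hων : ω ≤ (1 + C') * ω := by nlinarith
  have hωρ : ω ≤ ρ := hων.trans hsmall.le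
  have ha : 0 ≤ C' * ℓ' * γ * ω := by positivity
  have hsrc : ∀ k, C' * ℓ' * γ * ω * ω ^ k ≤ C' * ℓ' * γ * ω * ρ ^ k := fun k =>
    mul_le_mul_of_nonneg_left (pow_le_pow_left₀ hω hωρ k) ha
  exact (disc_le_of_twoRun_full (q := 1) hρ1 hω hC' hsmall ha hℓ' zero_le_one hA hB hAbox hBbox hpin
    (betaMismatch_le_of_represents (represents_generated _ _ γ) readLipschitz_id hAbox hBbox)
    (twoRunRenewal_of_scheme (linStep_direct hℓ') (linStep_memory hC' hω) (linStep_shift hℓ' hC' hω) hsrc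
      hAbox hBbox)
    (fun j _ => pairDist_nonneg _ gA gB K j) (linStep_fading hC' hω) hgain).1

end Witness

/-! ## §5 SHARPNESS OF THE NODE-U2 WINDOW: the loop-gain window is intrinsic to the two-point system

Gen-3 addendum of the P2 lineage (2026-08-19), APPENDED to v1 (v1's text above is byte-unchanged).  Every TWO-RUN
closure of node U2 in the tree (`T4TwoRunMatching.disc_le_of_twoRun` / `injectedRate_of_twoRun_runs` /
`disc_le_of_pureOneLoop`, `T4FlagMemoryTwoRun.disc_le_of_scheme_twoRun` / `injectedRate_of_scheme_twoRun[_on]`, and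
§§2–4 above) instantiates ONE kernel lemma, `T4TwoRunMatching.twoPoint_fixedPoint`, whose only non-structural
hypothesis is the LOOP-GAIN WINDOW `q·ē·κ ≤ (1 − ρ)/2` (read-out constant `q`, read-out weight bound `ē` — in cell
currency `q = cr`, `ē = ℓ′γ³` — and memory amplification `κ = (ρ − ω)/(ρ − (1 + C)ω)`); §3's primitive clause
`8·cr·ℓ′·γ³ ≤ (1 − ν)²` is that window at `ρ = (1 + ν)/2`, `κ ≤ 2/(1 − ν)`.  (The BOX-UNIFORM closures
`T4CouplingMatching.injectedRate_of_runs_eventual` / `T4FlagMemory.injectedRate_of_scheme` go through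
`T4CouplingMatching.twoSided_fixedPoint` instead, trading the weight bound `ē` for the AF summability of the weights
under `EventualLowerH` — and carry their own coupling window `cr·ℓ′·((k₀+1)γ³ + 2γ/b) ≤ (1 − ρ)/2`.  The OTHER
non-structural smallness of the node, the memory-rate GAP `(1 + C)ω < ρ`, is already known to be sharp:
`T4BetaMemory.constMemory_witness[_unbounded]`, `T4BetaMemorySharp.impulse_sharp` / `not_fadingMemory_below`; this
section concerns the loop-gain window only.)  It records, by explicit families of data satisfying EVERY OTHER
hypothesis of `twoPoint_fixedPoint`, that a window of this TYPE is NECESSARY for any `K`-uniform matching constant of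
the two-point system, and locates its ORDER in the gap `1 − ν`:

* (5.1) MEMORYLESS model (`M ≡ 0`): `K`-uniform bound iff `q·ē < 1 − ρ`, with the exact constant
  `(p + qa)/((1 − qē) − ρ)` (`twoPoint_memoryless`) and the resonant blow-up family `δ_j = (p + qa)(K − j)ρ^{j−1}` at
  `q·e = 1 − ρ` (`twoPoint_window_necessary`: `δ_0 = (p + qa)K/ρ → ∞`).  LINEAR in the gap: at `ρ = (1 + ν)/2` the
  threshold is `q·ē = (1 − ν)/2`.
* (5.2) WITH MEMORY inside the booked class `0 ≤ M_{j,i} ≤ Cω^{j−i}` (lag-one kernel of mass `μ ≤ Cω`): blow-up as soon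
  as `(1 − qē)((1 − ρ) − qē) < (1 − ρ)μ` (`twoPoint_memory_blowup`, `twoPoint_memory_window_necessary`; a capped
  bootstrap family: the backward step is solved with the guaranteed amplification `min Ā (Σ_{m≤j}(μ/(1 − qē))^m)` in
  place of the true one, and the forward renewal is then checked to dominate it).
* (5.3) AT THE PRIMITIVE BOOKING `ρ = (1 + ν)/2` with the memory rate saturating `ν` (`(1 + C)ω = ν`,
  `0 < ω < ν(1 − ν)²/2`): NO `K`-uniform constant once `2·q·ē ≥ (1 − ν)²` (`primitiveWindow_necessary`,
  `no_uniform_constant_at_primitive`), against the booked sufficiency `8·q·ē ≤ (1 − ν)²`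
  (`twoPoint_bounded_at_primitive`, = §3 `gain_of_primitive` + `twoPoint_fixedPoint`).  So the primitive clause is
  SHARP IN TYPE AND IN ORDER `(1 − ν)²`, up to the absolute factor 4, over the booked hypothesis class; the quadratic
  order is the price of MEMORY saturating the injected rate (`(1 + C′)ω = ν`); for a memoryless / fast-fading scheme
  (`(1 + C′)ω ≪ ν`, `κ = O(1)`) the honest window is the LINEAR one of (5.1) and the non-primitive closures
  (`injectedRate_of_fullScheme_twoRun`, `T4FlagMemoryTwoRun.injectedRate_of_scheme_twoRun`, explicit `κ`) should be
  cited instead of §4.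

READING FOR THE CELL (records only; nothing here is an estimate on Bałaban's (2.13)).  The «window» in the carver's
booking «NE4 = (M) + window» (T4-DAG v17 §6) is not an artefact of the P1/P2 closures: at SHAPE level — i.e. for data
constrained only by the read-out shape `TwoRunReadOut`/`ReadLipschitz`, the renewal shape `TwoRunRenewal`/`StepDirect`
+ `StepMemory` + `StepShift` and a fading-memory class `FadingMemory C′ ω` — matching through the β read-out loop is a
SMALL-COUPLING statement in an essential way (consistent with the `ForSmallCouplings` prefix of the cell's T4 headline),
and the only shape-level alternatives to a loop-gain window in `(cr, ℓ′γ³, gap)` are extra structure on the read-out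
weights `e_j = ℓ′(g^A_j)²g^B_{j+1}` (their AF summability along the runs — the box-uniform closure's `EventualLowerH`
input, `gain_of_afSmallness` — which is again a coupling window) or a small product `cr·ℓ′`.  The necessity families are
ABSTRACT data for `twoPoint_fixedPoint`; they are NOT realised here as runs of (0.20) under a scheme-generated β
(that realisation — the blow-up twin of §4's `disc_le_linStep` — is not attempted).  All [folklore]; nothing quoted;
NOT summit progress. -/

section Sharpness

/-- THE DATA HYPOTHESES OF `T4TwoRunMatching.twoPoint_fixedPoint`, bundled: `δ ≥ 0`; `s_j ≥ 0`, `0 ≤ e_j ≤ ē` for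
`j < K`; memory in the class `0 ≤ M_{j,i} ≤ Cω^{j−i}` (`i < j`); the pin `δ_K = 0`; the backward step
`δ_j ≤ δ_{j+1} + pρ^j + q·s_j` and the forward renewal `s_j ≤ aρ^j + e_j·δ_j + Σ_{i<j} M_{j,i}·s_i` for `j < K`.
(The remaining hypotheses of the fixed point are parameter signs, the gap `(1 + C)ω < ρ < 1` and the loop-gain
window.) [folklore] -/
def TwoPointData (K : ℕ) (δ s e : ℕ → ℝ) (M : ℕ → ℕ → ℝ) (a p q ē C ω ρ : ℝ) : Prop :=
  (∀ j, 0 ≤ δ j) ∧ (∀ j, j < K → 0 ≤ s j) ∧ (∀ j, j < K → 0 ≤ e j ∧ e j ≤ ē) ∧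
  (∀ j i, i < j → 0 ≤ M j i ∧ M j i ≤ C * ω ^ (j - i)) ∧ δ K = 0 ∧
  (∀ j, j < K → δ j ≤ δ (j + 1) + p * ρ ^ j + q * s j) ∧
  (∀ j, j < K → s j ≤ a * ρ ^ j + e j * δ j + ∑ i ∈ range j, M j i * s i)

/-- `TwoPointData` IS the data-hypothesis list of the fixed point: with the signs, the gap and the window,
`twoPoint_fixedPoint` applies verbatim. [folklore] -/
theorem twoPoint_fixedPoint_of_data {K : ℕ} {δ s e : ℕ → ℝ} {M : ℕ → ℕ → ℝ} {a p q ē C ω ρ : ℝ}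
    (hρ1 : ρ < 1) (hω : 0 ≤ ω) (hC : 0 ≤ C) (hsmall : (1 + C) * ω < ρ)
    (ha : 0 ≤ a) (hp : 0 ≤ p) (hq : 0 ≤ q) (hē : 0 ≤ ē)
    (hdata : TwoPointData K δ s e M a p q ē C ω ρ)
    (hgain : q * ē * ((ρ - ω) / (ρ - (1 + C) * ω)) ≤ (1 - ρ) / 2) :
    ∀ j, j ≤ K → δ j ≤ 2 * (p + q * a * ((ρ - ω) / (ρ - (1 + C) * ω))) / (1 - ρ) * ρ ^ j :=
  (twoPoint_fixedPoint hρ1 hω hC hsmall ha hp hq hē hdata.1 hdata.2.1 hdata.2.2.1 hdata.2.2.2.1 hdata.2.2.2.2.1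
    hdata.2.2.2.2.2.1 hdata.2.2.2.2.2.2 hgain).1

/-! ### (5.1) The memoryless model: exact threshold `q·ē = 1 − ρ` -/

/-- **MEMORYLESS EXACT SUFFICIENCY.**  Without memory (`s_j ≤ aρ^j + e_j·δ_j`), the backward step absorbs the read-out
loop as soon as `q·ē < 1 − ρ`: `δ_j ≤ (p + q·a)/((1 − q·ē) − ρ)·ρ^j` for `j ≤ K` — constant free of `K`, NO factor 2,
NO κ (descending induction on `(1 − qē)δ_j ≤ δ_{j+1} + (p + qa)ρ^j`).  The threshold is attained:
`twoPoint_window_necessary`. [folklore] -/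
theorem twoPoint_memoryless {K : ℕ} {δ s e : ℕ → ℝ} {a p q ē ρ : ℝ}
    (hρ0 : 0 ≤ ρ) (hq : 0 ≤ q) (ha : 0 ≤ a) (hp : 0 ≤ p) (hwin : q * ē < 1 - ρ)
    (hδ : ∀ j, 0 ≤ δ j) (he : ∀ j, j < K → 0 ≤ e j ∧ e j ≤ ē)
    (hK : δ K = 0)
    (hback : ∀ j, j < K → δ j ≤ δ (j + 1) + p * ρ ^ j + q * s j)
    (hfwd : ∀ j, j < K → s j ≤ a * ρ ^ j + e j * δ j) :
    ∀ j, j ≤ K → δ j ≤ (p + q * a) / ((1 - q * ē) - ρ) * ρ ^ j := by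
  set r := 1 - q * ē with hr
  set c := p + q * a with hc
  have hrρ : 0 < r - ρ := by rw [hr]; linarith
  have hr0 : 0 < r := by linarith
  have hc0 : 0 ≤ c := by positivity
  have hstep : ∀ j, j < K → r * δ j ≤ δ (j + 1) + c * ρ ^ j := by
    intro j hj
    have h1 := hback j hj
    have h2 := hfwd j hj
    have h4 : q * (e j * δ j) ≤ q * (ē * δ j) :=
      mul_le_mul_of_nonneg_left (mul_le_mul_of_nonneg_right (he j hj).2 (hδ j)) hq
    have : δ j ≤ δ (j + 1) + c * ρ ^ j + q * ē * δ j := by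
      calc δ j ≤ δ (j + 1) + p * ρ ^ j + q * s j := h1
        _ ≤ δ (j + 1) + p * ρ ^ j + q * (a * ρ ^ j + e j * δ j) := by
            linarith [mul_le_mul_of_nonneg_left h2 hq]
        _ = δ (j + 1) + c * ρ ^ j + q * (e j * δ j) := by rw [hc]; ring
        _ ≤ δ (j + 1) + c * ρ ^ j + q * (ē * δ j) := by linarith
        _ = δ (j + 1) + c * ρ ^ j + q * ē * δ j := by ring
    rw [hr]; linarith
  suffices H : ∀ d j, j + d = K → δ j ≤ c / (r - ρ) * ρ ^ j from
    fun j hj => H (K - j) j (Nat.add_sub_cancel' hj)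
  intro d
  induction d with
  | zero =>
    intro j hj
    rw [add_zero] at hj
    subst hj
    rw [hK]
    exact mul_nonneg (div_nonneg hc0 hrρ.le) (pow_nonneg hρ0 j)
  | succ d ih =>
    intro j hj
    have hjK : j < K := by omega
    have h1 := hstep j hjK
    have h2 := ih (j + 1) (by omega)
    have h3 : r * δ j ≤ c / (r - ρ) * ρ ^ (j + 1) + c * ρ ^ j := by linarith
    have h4 : c / (r - ρ) * ρ ^ (j + 1) + c * ρ ^ j = r * (c / (r - ρ) * ρ ^ j) := by
      field_simp
      ring
    rw [h4] at h3
    exact le_of_mul_le_mul_left h3 hr0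

/-- The RESONANT MEMORYLESS FAMILY at the threshold `q·e = 1 − ρ`: `δ_j = c·(K − j)·ρ^j/ρ` (natural subtraction:
`0` beyond the pin). [folklore] -/
noncomputable def resonantDisc (c ρ : ℝ) (K j : ℕ) : ℝ := c * ((K - j : ℕ) : ℝ) * ρ ^ j / ρ

/-- `resonantDisc ≥ 0` for `c, ρ ≥ 0`. [folklore] -/
theorem resonantDisc_nonneg {c ρ : ℝ} (hc : 0 ≤ c) (hρ : 0 ≤ ρ) (K j : ℕ) : 0 ≤ resonantDisc c ρ K j := by
  unfold resonantDisc; positivity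

/-- The pin: `resonantDisc c ρ K K = 0`. [folklore] -/
theorem resonantDisc_pin (c ρ : ℝ) (K : ℕ) : resonantDisc c ρ K K = 0 := by simp [resonantDisc]

/-- The initial value: `resonantDisc c ρ K 0 = c·K/ρ` — LINEAR IN `K`. [folklore] -/
theorem resonantDisc_zero {c ρ : ℝ} (K : ℕ) : resonantDisc c ρ K 0 = c * K / ρ := by
  simp [resonantDisc]

/-- The backward step WITH EQUALITY: `ρ·δ_j = δ_{j+1} + c·ρ^j` for `j < K` (`0 < ρ`). [folklore] -/
theorem resonantDisc_step {c ρ : ℝ} (hρ : 0 < ρ) {K j : ℕ} (hj : j < K) :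
    ρ * resonantDisc c ρ K j = resonantDisc c ρ K (j + 1) + c * ρ ^ j := by
  unfold resonantDisc
  have h1 : ((K - j : ℕ) : ℝ) = ((K - (j + 1) : ℕ) : ℝ) + 1 := by
    have : K - j = (K - (j + 1)) + 1 := by omega
    rw [this]; push_cast; ring
  rw [h1, pow_succ]
  field_simp

/-- **THE LOOP-GAIN WINDOW IS NECESSARY — memoryless model, exact threshold.**  For `0 < ρ < 1`, `q > 0`, source
`p + q·a > 0` and ANY weight bound `ē ≥ (1 − ρ)/q` (i.e. `q·ē ≥ 1 − ρ`), and for every candidate constant `D`, there are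
`K` and data `(δ, s, e, M)` with `M ≡ 0` (inside every class `Cω^{j−i}`, `C, ω ≥ 0` — so the gap hypothesis of the
fixed point is free) satisfying `TwoPointData` with `δ_0 > D`: the resonant family `δ_j = (p + qa)(K − j)ρ^{j−1}`,
`e ≡ (1 − ρ)/q`, `s_j = aρ^j + e·δ_j`, backward step and renewal WITH EQUALITY, `δ_0 = (p + qa)K/ρ`.  Hence no
`K`-uniform matching constant exists at or beyond the threshold; with `twoPoint_memoryless` the memoryless threshold
is EXACTLY `q·ē = 1 − ρ` (cell currency: `cr·ℓ′γ³ = 1 − ρ`). [folklore] -/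
theorem twoPoint_window_necessary {a p q ē ρ C ω : ℝ} (hρ0 : 0 < ρ) (hρ1 : ρ < 1) (hq : 0 < q)
    (ha : 0 ≤ a) (hsrc : 0 < p + q * a) (hē : (1 - ρ) / q ≤ ē) (hC : 0 ≤ C) (hω : 0 ≤ ω) (D : ℝ) :
    ∃ (K : ℕ) (δ s e : ℕ → ℝ) (M : ℕ → ℕ → ℝ), TwoPointData K δ s e M a p q ē C ω ρ ∧ D < δ 0 := by
  set c := p + q * a with hc
  set e₀ := (1 - ρ) / q with he₀
  have he₀0 : 0 ≤ e₀ := div_nonneg (by linarith) hq.le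
  have hqe₀ : q * e₀ = 1 - ρ := by rw [he₀]; field_simp
  obtain ⟨K, hK⟩ := exists_nat_gt (D * ρ / c)
  refine ⟨K, resonantDisc c ρ K, fun j => a * ρ ^ j + e₀ * resonantDisc c ρ K j, fun _ => e₀, fun _ _ => 0,
    ⟨fun j => resonantDisc_nonneg hsrc.le hρ0.le K j, ?_, fun j _ => ⟨he₀0, hē⟩, ?_, resonantDisc_pin c ρ K,
    ?_, ?_⟩, ?_⟩
  · intro j _
    have := resonantDisc_nonneg hsrc.le hρ0.le K j
    positivity
  · intro j i _
    exact ⟨le_rfl, by positivity⟩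
  · intro j hj
    have hstep := resonantDisc_step (c := c) hρ0 hj
    have e1 : q * (a * ρ ^ j + e₀ * resonantDisc c ρ K j)
        = q * a * ρ ^ j + (1 - ρ) * resonantDisc c ρ K j := by
      rw [← hqe₀]; ring
    rw [e1]
    have hc' : c * ρ ^ j = p * ρ ^ j + q * a * ρ ^ j := by rw [hc]; ring
    nlinarith [hstep, hc']
  · intro j _
    simp
  · show D < resonantDisc c ρ K 0
    rw [resonantDisc_zero]
    rw [div_lt_iff₀ hsrc] at hK
    rw [lt_div_iff₀ hρ0]
    linarith

/-! ### (5.2) With memory inside the class `M_{j,i} ≤ Cω^{j−i}`: the capped bootstrap family -/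

/-- Guaranteed memory amplification after `j` steps, capped: `min Ā (Σ_{m ≤ j} x^m)` (`x = μ/(1 − qē)`). [folklore] -/
noncomputable def amplSeq (x Ā : ℝ) (j : ℕ) : ℝ := min Ā (∑ m ∈ range (j + 1), x ^ m)

/-- `amplSeq ≥ 1` (`x ≥ 0`, `Ā ≥ 1`). [folklore] -/
theorem one_le_amplSeq {x Ā : ℝ} (hx : 0 ≤ x) (hĀ : 1 ≤ Ā) (j : ℕ) : 1 ≤ amplSeq x Ā j := by
  refine le_min hĀ ?_
  have h : x ^ 0 ≤ ∑ m ∈ range (j + 1), x ^ m :=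
    Finset.single_le_sum (f := fun m => x ^ m) (fun m _ => pow_nonneg hx m) (by simp)
  simpa using h

/-- `amplSeq ≤ Ā`. [folklore] -/
theorem amplSeq_le_cap (x Ā : ℝ) (j : ℕ) : amplSeq x Ā j ≤ Ā := min_le_left _ _

/-- `amplSeq ≤ Σ_{m ≤ j} x^m`. [folklore] -/
theorem amplSeq_le_sum (x Ā : ℝ) (j : ℕ) : amplSeq x Ā j ≤ ∑ m ∈ range (j + 1), x ^ m := min_le_right _ _

/-- If `Ā·(1 − x) < 1` (`x ≥ 0`), the partial geometric sums eventually exceed the cap: `amplSeq x Ā j = Ā` for all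
large `j` (for `x ≥ 1` the sums grow at least linearly; for `x < 1` they tend to `1/(1 − x) > Ā`). [folklore] -/
theorem amplSeq_eventually_cap {x Ā : ℝ} (hx : 0 ≤ x) (hcap : Ā * (1 - x) < 1) :
    ∃ j₁ : ℕ, ∀ j, j₁ ≤ j → amplSeq x Ā j = Ā := by
  suffices H : ∃ j₁ : ℕ, Ā ≤ ∑ m ∈ range (j₁ + 1), x ^ m by
    obtain ⟨j₁, hj₁⟩ := H
    refine ⟨j₁, fun j hj => min_eq_left (hj₁.trans ?_)⟩
    exact Finset.sum_le_sum_of_subset_of_nonneg (Finset.range_mono (Nat.succ_le_succ hj))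
      (fun m _ _ => pow_nonneg hx m)
  by_cases hx1 : 1 ≤ x
  · obtain ⟨j₁, hj₁⟩ := exists_nat_ge Ā
    refine ⟨j₁, hj₁.trans ?_⟩
    have h : ∑ _m ∈ range (j₁ + 1), (1 : ℝ) ≤ ∑ m ∈ range (j₁ + 1), x ^ m :=
      Finset.sum_le_sum fun m _ => one_le_pow₀ hx1
    have e : ∑ _m ∈ range (j₁ + 1), (1 : ℝ) = (j₁ : ℝ) + 1 := by simp
    linarith [h, e]
  · rw [not_le] at hx1
    have hη : 0 < 1 - Ā * (1 - x) := by linarith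
    obtain ⟨n, hn⟩ := exists_pow_lt_of_lt_one hη hx1
    refine ⟨n, ?_⟩
    have hgeom : (∑ m ∈ range (n + 1), x ^ m) * (1 - x) = 1 - x ^ (n + 1) := by
      have h := geom_sum_mul_neg x (n + 1)
      linarith [h]
    have hxn : x ^ (n + 1) ≤ x ^ n := by
      rw [pow_succ]; exact mul_le_of_le_one_right (pow_nonneg hx n) hx1.le
    have h1x : 0 < 1 - x := by linarith
    have : Ā * (1 - x) ≤ (∑ m ∈ range (n + 1), x ^ m) * (1 - x) := by
      rw [hgeom]; linarith
    exact le_of_mul_le_mul_right this h1x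

/-- Backward-defined discrepancies, indexed by the distance `d = K − j` to the pin: `F 0 = 0`,
`F (d+1) = (F d + c·ρ^{K−d−1}) / r_{K−d−1}`. [folklore] -/
noncomputable def bwdAux (c ρ : ℝ) (r : ℕ → ℝ) (K : ℕ) : ℕ → ℝ
  | 0 => 0
  | d + 1 => (bwdAux c ρ r K d + c * ρ ^ (K - (d + 1))) / r (K - (d + 1))

/-- `δ_j := F (K − j)` for `j ≤ K`, `0` beyond the pin. [folklore] -/
noncomputable def bwdDisc (c ρ : ℝ) (r : ℕ → ℝ) (K j : ℕ) : ℝ :=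
  if j ≤ K then bwdAux c ρ r K (K - j) else 0

/-- The pin: `bwdDisc … K K = 0`. [folklore] -/
theorem bwdDisc_pin (c ρ : ℝ) (r : ℕ → ℝ) (K : ℕ) : bwdDisc c ρ r K K = 0 := by
  simp [bwdDisc, bwdAux]

/-- The backward step WITH EQUALITY: `δ_j · r_j = δ_{j+1} + c·ρ^j` for `j < K` (`r_j ≠ 0`). [folklore] -/
theorem bwdDisc_step {c ρ : ℝ} {r : ℕ → ℝ} {K j : ℕ} (hj : j < K) (hr : r j ≠ 0) :
    bwdDisc c ρ r K j * r j = bwdDisc c ρ r K (j + 1) + c * ρ ^ j := by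
  have hd : K - j = (K - (j + 1)) + 1 := by omega
  have hKd : K - ((K - (j + 1)) + 1) = j := by omega
  simp only [bwdDisc, if_pos hj.le, if_pos (Nat.succ_le_of_lt hj)]
  rw [hd, bwdAux, hKd, div_mul_cancel₀ _ hr]

/-- `bwdAux ≥ 0` for `c, ρ ≥ 0` and positive gains. [folklore] -/
theorem bwdAux_nonneg {c ρ : ℝ} {r : ℕ → ℝ} (hc : 0 ≤ c) (hρ : 0 ≤ ρ) (hr : ∀ j, 0 < r j) (K : ℕ) :
    ∀ d, 0 ≤ bwdAux c ρ r K d := by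
  intro d
  induction d with
  | zero => simp [bwdAux]
  | succ d ih =>
    simp only [bwdAux]
    exact div_nonneg (add_nonneg ih (mul_nonneg hc (pow_nonneg hρ _))) (hr _).le

/-- `bwdDisc ≥ 0` for `c, ρ ≥ 0` and positive gains. [folklore] -/
theorem bwdDisc_nonneg {c ρ : ℝ} {r : ℕ → ℝ} (hc : 0 ≤ c) (hρ : 0 ≤ ρ) (hr : ∀ j, 0 < r j) (K j : ℕ) :
    0 ≤ bwdDisc c ρ r K j := by
  unfold bwdDisc
  split_ifs
  · exact bwdAux_nonneg hc hρ hr K _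
  · exact le_rfl

/-- Forward brackets with source `aρ^j`, constant weight `ē` and LAG-ONE memory of mass `μ`:
`s_0 = a + ē·δ_0`, `s_{j+1} = aρ^{j+1} + ē·δ_{j+1} + μ·s_j`. [folklore] -/
noncomputable def fwdBracket (a ρ ē μ : ℝ) (δ : ℕ → ℝ) : ℕ → ℝ
  | 0 => a + ē * δ 0
  | j + 1 => a * ρ ^ (j + 1) + ē * δ (j + 1) + μ * fwdBracket a ρ ē μ δ j

/-- The lag-one memory kernel of mass `μ`: `M_{j,i} = μ` if `i = j − 1`, else `0`. [folklore] -/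
noncomputable def lagOne (μ : ℝ) (j i : ℕ) : ℝ := if i + 1 = j then μ else 0

/-- `Σ_{i ≤ j} lagOne μ (j+1) i · f_i = μ·f_j`. [folklore] -/
theorem lagOne_sum (μ : ℝ) (f : ℕ → ℝ) (j : ℕ) :
    ∑ i ∈ range (j + 1), lagOne μ (j + 1) i * f i = μ * f j := by
  rw [Finset.sum_eq_single j]
  · simp [lagOne]
  · intro i _ hij
    simp [lagOne, hij]
  · intro h; simp at h

/-- The forward renewal WITH EQUALITY for `fwdBracket` and the kernel `lagOne μ`. [folklore] -/
theorem fwdBracket_renewal (a ρ ē μ : ℝ) (δ : ℕ → ℝ) (j : ℕ) :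
    fwdBracket a ρ ē μ δ j = a * ρ ^ j + ē * δ j + ∑ i ∈ range j, lagOne μ j i * fwdBracket a ρ ē μ δ i := by
  cases j with
  | zero => simp [fwdBracket]
  | succ j => rw [lagOne_sum]; simp [fwdBracket]

/-- `fwdBracket ≥ 0` for nonnegative parameters and `δ ≥ 0`. [folklore] -/
theorem fwdBracket_nonneg {a ρ ē μ : ℝ} {δ : ℕ → ℝ} (ha : 0 ≤ a) (hρ : 0 ≤ ρ) (hē : 0 ≤ ē) (hμ : 0 ≤ μ)
    (hδ : ∀ j, 0 ≤ δ j) : ∀ j, 0 ≤ fwdBracket a ρ ē μ δ j := by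
  intro j
  induction j with
  | zero => simp only [fwdBracket]; nlinarith [hδ 0]
  | succ j ih =>
    simp only [fwdBracket]
    have := hδ (j + 1)
    positivity

/-- MEMORY BUILD-UP (the amplification lower bound): if `δ` decays no faster than `r̂ > 0` per step below `j`
(`δ_{i+1} ≤ r̂·δ_i` for `i < j`), then `s_j ≥ aρ^j + ē·(Σ_{m ≤ j} (μ/r̂)^m)·δ_j` (induction on `j`, dropping the memory
of the source). [folklore] -/
theorem fwdBracket_lower {a ρ ē μ rh : ℝ} {δ : ℕ → ℝ} (ha : 0 ≤ a) (hρ : 0 ≤ ρ) (hē : 0 ≤ ē) (hμ : 0 ≤ μ)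
    (hrh : 0 < rh) :
    ∀ j, (∀ i, i < j → δ (i + 1) ≤ rh * δ i) →
      a * ρ ^ j + ē * (∑ m ∈ range (j + 1), (μ / rh) ^ m) * δ j ≤ fwdBracket a ρ ē μ δ j := by
  intro j
  induction j with
  | zero => intro _; simp [fwdBracket]
  | succ j ih =>
    intro hdec
    have ih' := ih fun i hi => hdec i (Nat.lt_succ_of_lt hi)
    have hstep : δ (j + 1) ≤ rh * δ j := hdec j (Nat.lt_succ_self j)
    set S := ∑ m ∈ range (j + 1), (μ / rh) ^ m with hS
    have hS0 : 0 ≤ S := Finset.sum_nonneg fun m _ => pow_nonneg (div_nonneg hμ hrh.le) m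
    have hsucc : ∑ m ∈ range (j + 1 + 1), (μ / rh) ^ m = μ / rh * S + 1 := geom_sum_succ
    rw [hsucc]
    simp only [fwdBracket]
    have h1 : μ * (a * ρ ^ j + ē * S * δ j) ≤ μ * fwdBracket a ρ ē μ δ j :=
      mul_le_mul_of_nonneg_left ih' hμ
    have h2 : 0 ≤ μ * (a * ρ ^ j) := by positivity
    have h3 : ē * (μ / rh * S) * δ (j + 1) ≤ μ * (ē * S * δ j) := by
      have e1 : ē * (μ / rh * S) * δ (j + 1) = (μ * ē * S) / rh * δ (j + 1) := by ring
      have e2 : μ * (ē * S * δ j) = (μ * ē * S) / rh * (rh * δ j) := by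
        field_simp
      rw [e1, e2]
      exact mul_le_mul_of_nonneg_left hstep (by positivity)
    nlinarith [h1, h2, h3]

/-- **BLOW-UP WITH MEMORY (the capped bootstrap family).**  Rate `0 < ρ < 1`, read-out constant `q > 0`, weight
`ē > 0`, lag-one memory mass `μ ≥ 0` with `μ ≤ Cω` (so `lagOne μ` is inside the class `Cω^{j−i}`), source
`p + q·a > 0`, and an amplification cap `Ā ≥ 1` with `1 − ρ < q·ē·Ā < 1` which the partial sums
`Σ (μ/(1 − qē))^m` eventually exceed (`Ā·((1 − qē) − μ) < 1 − qē`).  Then for every `D` there are `K` and data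
satisfying `TwoPointData` with `δ_0 > D`.  Construction: gains `r_j = 1 − qē·amplSeq (μ/(1 − qē)) Ā j`, `δ = bwdDisc`
(backward step with equality against the GUARANTEED amplification), `s = fwdBracket` (renewal with equality),
`e ≡ ē`, `M = lagOne μ`; the true renewal dominates the guaranteed amplification by `fwdBracket_lower` (the bootstrap
closes because `r_j ≤ 1 − qē`), and past the saturation index `j₁` the gains equal `1 − qēĀ < ρ`, so
`δ_0 ≥ (p + qa)ρ^{j₁}(ρ/(1 − qēĀ))^n → ∞`. [folklore] -/
theorem twoPoint_memory_blowup {a p q ē μ ρ Ā C ω : ℝ} (hρ0 : 0 < ρ) (hρ1 : ρ < 1) (hq : 0 < q) (hē : 0 < ē)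
    (ha : 0 ≤ a) (hsrc : 0 < p + q * a) (hμ : 0 ≤ μ)
    (hĀ1 : 1 ≤ Ā) (hglt : q * ē * Ā < 1) (hggt : 1 - ρ < q * ē * Ā)
    (hcap : Ā * ((1 - q * ē) - μ) < 1 - q * ē)
    (hC : μ ≤ C * ω) (hC0 : 0 ≤ C) (hω : 0 ≤ ω) (D : ℝ) :
    ∃ (K : ℕ) (δ s e : ℕ → ℝ) (M : ℕ → ℕ → ℝ), TwoPointData K δ s e M a p q ē C ω ρ ∧ D < δ 0 := by
  set c := p + q * a with hc
  have hqē : 0 < q * ē := mul_pos hq hē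
  have hqē1 : q * ē < 1 := by nlinarith
  set rh := 1 - q * ē with hrh
  have hrh0 : 0 < rh := by rw [hrh]; linarith
  set x := μ / rh with hx
  have hx0 : 0 ≤ x := div_nonneg hμ hrh0.le
  set r : ℕ → ℝ := fun j => 1 - q * ē * amplSeq x Ā j with hr
  set rs := 1 - q * ē * Ā with hrs
  have hrs0 : 0 < rs := by rw [hrs]; linarith
  have hrsρ : rs < ρ := by rw [hrs]; linarith
  have hr_lo : ∀ j, rs ≤ r j := fun j => by
    simp only [hr, hrs]
    nlinarith [amplSeq_le_cap x Ā j, hqē]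
  have hr_pos : ∀ j, 0 < r j := fun j => lt_of_lt_of_le hrs0 (hr_lo j)
  have hr_hi : ∀ j, r j ≤ rh := fun j => by
    simp only [hr, hrh]
    nlinarith [one_le_amplSeq hx0 hĀ1 j, hqē]
  have hr_le1 : ∀ j, r j ≤ 1 := fun j => (hr_hi j).trans (by rw [hrh]; linarith)
  have hcap' : Ā * (1 - x) < 1 := by
    have e : Ā * (1 - x) = Ā * (rh - μ) / rh := by rw [hx]; field_simp
    rw [e, div_lt_one hrh0]
    simpa [hrh] using hcap
  obtain ⟨j₁, hj₁⟩ := amplSeq_eventually_cap hx0 hcap'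
  have hr_sat : ∀ j, j₁ ≤ j → r j = rs := fun j hj => by simp only [hr, hrs, hj₁ j hj]
  set t := ρ / rs - 1 with ht
  have ht0 : 0 < t := by rw [ht, sub_pos, lt_div_iff₀ hrs0]; linarith
  have hcρ : 0 < c * ρ ^ j₁ := mul_pos hsrc (pow_pos hρ0 j₁)
  obtain ⟨n, hn⟩ := exists_nat_gt ((D / (c * ρ ^ j₁) - 1) / t)
  set K := j₁ + n + 1 with hK
  set δ := bwdDisc c ρ r K with hδdef
  set s := fwdBracket a ρ ē μ δ with hsdef
  have hδ0 : ∀ j, 0 ≤ δ j := fun j => bwdDisc_nonneg hsrc.le hρ0.le hr_pos K j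
  have hs0 : ∀ j, 0 ≤ s j := fwdBracket_nonneg ha hρ0.le hē.le hμ hδ0
  have hstep : ∀ j, j < K → δ j * r j = δ (j + 1) + c * ρ ^ j := fun j hj =>
    bwdDisc_step hj (hr_pos j).ne'
  have hdec : ∀ j, j < K → δ (j + 1) ≤ rh * δ j := by
    intro j hj
    have h1 := hstep j hj
    have h2 : 0 ≤ c * ρ ^ j := mul_nonneg hsrc.le (pow_nonneg hρ0.le j)
    have h3 : δ j * r j ≤ δ j * rh := mul_le_mul_of_nonneg_left (hr_hi j) (hδ0 j)
    linarith
  refine ⟨K, δ, s, fun _ => ē, lagOne μ, ⟨hδ0, fun j _ => hs0 j, fun j _ => ⟨hē.le, le_rfl⟩, ?_,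
    bwdDisc_pin c ρ r K, ?_, ?_⟩, ?_⟩
  · -- the memory kernel is inside the class
    intro j i hij
    by_cases h : i + 1 = j
    · subst h
      refine ⟨by simp [lagOne, hμ], ?_⟩
      simp only [lagOne, if_true, Nat.add_sub_cancel_left, pow_one]
      exact hC
    · refine ⟨by simp [lagOne, h], ?_⟩
      simp only [lagOne, h, if_false]
      positivity
  · -- backward step: δ_j = δ_{j+1} + cρ^j + qē·ampl_j·δ_j ≤ δ_{j+1} + pρ^j + q·s_j
    intro j hj
    have h1 := hstep j hj
    have hlow := fwdBracket_lower (δ := δ) ha hρ0.le hē.le hμ hrh0 j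
      (fun i hi => hdec i (lt_trans hi hj))
    have h2 : amplSeq x Ā j ≤ ∑ m ∈ range (j + 1), (μ / rh) ^ m := amplSeq_le_sum x Ā j
    have h3 : q * (ē * amplSeq x Ā j * δ j) ≤ q * (ē * (∑ m ∈ range (j + 1), (μ / rh) ^ m) * δ j) :=
      mul_le_mul_of_nonneg_left (mul_le_mul_of_nonneg_right (mul_le_mul_of_nonneg_left h2 hē.le) (hδ0 j)) hq.le
    have e1 : δ j = δ (j + 1) + c * ρ ^ j + q * (ē * amplSeq x Ā j * δ j) := by
      have : δ j * r j = δ j - q * (ē * amplSeq x Ā j * δ j) := by simp only [hr]; ring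
      linarith [h1, this]
    have hs_lo : q * (a * ρ ^ j + ē * (∑ m ∈ range (j + 1), (μ / rh) ^ m) * δ j) ≤ q * s j :=
      mul_le_mul_of_nonneg_left hlow hq.le
    have e2 : c * ρ ^ j = p * ρ ^ j + q * (a * ρ ^ j) := by rw [hc]; ring
    nlinarith [e1, e2, h3, hs_lo]
  · -- forward renewal (with equality)
    intro j _
    show s j ≤ a * ρ ^ j + ē * δ j + ∑ i ∈ range j, lagOne μ j i * s i
    exact le_of_eq (fwdBracket_renewal a ρ ē μ δ j)
  · -- blow-up: δ_0 ≥ δ_{j₁} ≥ δ_{K−1}/rs^n ≥ cρ^{K−1}/rs^n = cρ^{j₁}(ρ/rs)^n ≥ cρ^{j₁}(1 + n·t) > D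
    have hmono : ∀ j, j < K → δ (j + 1) ≤ δ j := by
      intro j hj
      have h1 := hstep j hj
      have h2 : 0 ≤ c * ρ ^ j := mul_nonneg hsrc.le (pow_nonneg hρ0.le j)
      have h3 : δ j * r j ≤ δ j := by nlinarith [hr_le1 j, hδ0 j, hr_pos j]
      linarith
    have hchain0 : ∀ j, j ≤ K → δ j ≤ δ 0 := by
      intro j
      induction j with
      | zero => intro _; exact le_rfl
      | succ j ih => intro hj; exact (hmono j (by omega)).trans (ih (by omega))
    have hchain1 : ∀ m, j₁ + m ≤ K → δ (j₁ + m) ≤ rs ^ m * δ j₁ := by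
      intro m
      induction m with
      | zero => intro _; simp
      | succ m ih =>
        intro hm
        have hlt : j₁ + m < K := by omega
        have h1 := hstep (j₁ + m) hlt
        rw [hr_sat (j₁ + m) (by omega)] at h1
        have h2 : 0 ≤ c * ρ ^ (j₁ + m) := mul_nonneg hsrc.le (pow_nonneg hρ0.le _)
        have h3 : δ (j₁ + m + 1) ≤ rs * δ (j₁ + m) := by linarith
        have h4 := ih (by omega)
        calc δ (j₁ + (m + 1)) = δ (j₁ + m + 1) := by rw [Nat.add_assoc]
          _ ≤ rs * δ (j₁ + m) := h3
          _ ≤ rs * (rs ^ m * δ j₁) := mul_le_mul_of_nonneg_left h4 hrs0.le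
          _ = rs ^ (m + 1) * δ j₁ := by ring
    have hlast : c * ρ ^ (j₁ + n) ≤ δ (j₁ + n) := by
      have hlt : j₁ + n < K := by omega
      have h1 := hstep (j₁ + n) hlt
      have hpin : δ (j₁ + n + 1) = 0 := by
        have : j₁ + n + 1 = K := by omega
        rw [this]; exact bwdDisc_pin c ρ r K
      rw [hpin, zero_add] at h1
      have h3 : δ (j₁ + n) * r (j₁ + n) ≤ δ (j₁ + n) := by
        nlinarith [hr_le1 (j₁ + n), hδ0 (j₁ + n), hr_pos (j₁ + n)]
      linarith
    have hA : c * ρ ^ (j₁ + n) ≤ rs ^ n * δ j₁ := hlast.trans (hchain1 n (by omega))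
    have hB : δ j₁ ≤ δ 0 := hchain0 j₁ (by omega)
    have hrsn : 0 < rs ^ n := pow_pos hrs0 n
    have hC1 : c * ρ ^ j₁ * (ρ / rs) ^ n ≤ δ j₁ := by
      have e : c * ρ ^ j₁ * (ρ / rs) ^ n = c * ρ ^ (j₁ + n) / rs ^ n := by
        rw [div_pow, pow_add]; ring
      rw [e, div_le_iff₀ hrsn]
      linarith [hA, mul_comm (rs ^ n) (δ j₁)]
    have hbern : 1 + (n : ℝ) * t ≤ (ρ / rs) ^ n := by
      have e : ρ / rs = 1 + t := by rw [ht]; ring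
      rw [e]
      exact one_add_mul_le_pow (by linarith) n
    have hC2 : c * ρ ^ j₁ * (1 + (n : ℝ) * t) ≤ δ j₁ :=
      (mul_le_mul_of_nonneg_left hbern hcρ.le).trans hC1
    have hD : D < c * ρ ^ j₁ * (1 + (n : ℝ) * t) := by
      have h1 : (D / (c * ρ ^ j₁) - 1) / t < n := hn
      rw [div_lt_iff₀ ht0] at h1
      have h2 : D / (c * ρ ^ j₁) < 1 + (n : ℝ) * t := by linarith
      rw [div_lt_iff₀ hcρ] at h2
      linarith [h2]
    show D < δ 0
    linarith [hD, hC2, hB]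

/-- **THE LOOP-GAIN WINDOW IS NECESSARY — WITH MEMORY.**  Below the memoryless threshold (`q·ē < 1 − ρ`) a lag-one
memory of mass `μ ≤ Cω` still forces blow-up as soon as `(1 − qē)·((1 − ρ) − qē) < (1 − ρ)·μ` — equivalently, the
read-out loop amplified by the memory factor `(1 − qē)/((1 − qē) − μ)` exceeds `1 − ρ`.  (The cap `Ā` of
`twoPoint_memory_blowup` is chosen strictly between `(1 − ρ)/(qē)` and `min (1/(qē)) ((1 − qē)/((1 − qē) − μ))`.)
[folklore] -/
theorem twoPoint_memory_window_necessary {a p q ē μ ρ C ω : ℝ} (hρ0 : 0 < ρ) (hρ1 : ρ < 1) (hq : 0 < q)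
    (hē : 0 < ē) (ha : 0 ≤ a) (hsrc : 0 < p + q * a) (hμ : 0 ≤ μ) (hwin : q * ē < 1 - ρ)
    (hblow : (1 - q * ē) * ((1 - ρ) - q * ē) < (1 - ρ) * μ)
    (hC : μ ≤ C * ω) (hC0 : 0 ≤ C) (hω : 0 ≤ ω) (D : ℝ) :
    ∃ (K : ℕ) (δ s e : ℕ → ℝ) (M : ℕ → ℕ → ℝ), TwoPointData K δ s e M a p q ē C ω ρ ∧ D < δ 0 := by
  have hqē : 0 < q * ē := mul_pos hq hē
  have hL1 : 1 < (1 - ρ) / (q * ē) := by rw [lt_div_iff₀ hqē]; linarith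
  have hLU₁ : (1 - ρ) / (q * ē) < 1 / (q * ē) := by
    rw [div_lt_div_iff_of_pos_right hqē]; linarith
  by_cases hden : 0 < (1 - q * ē) - μ
  · have hLU₂ : (1 - ρ) / (q * ē) < (1 - q * ē) / ((1 - q * ē) - μ) := by
      rw [div_lt_div_iff₀ hqē hden]
      nlinarith [hblow]
    obtain ⟨Ā, hĀlo, hĀhi⟩ := exists_between (lt_min hLU₁ hLU₂)
    have hĀ1 : Ā < 1 / (q * ē) := lt_of_lt_of_le hĀhi (min_le_left _ _)
    have hĀ2 : Ā < (1 - q * ē) / ((1 - q * ē) - μ) := lt_of_lt_of_le hĀhi (min_le_right _ _)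
    refine twoPoint_memory_blowup hρ0 hρ1 hq hē ha hsrc hμ (hL1.le.trans hĀlo.le) ?_ ?_ ?_ hC hC0 hω D
    · have := (lt_div_iff₀ hqē).mp hĀ1; linarith
    · have := (div_lt_iff₀ hqē).mp hĀlo; linarith
    · exact (lt_div_iff₀ hden).mp hĀ2
  · rw [not_lt] at hden
    obtain ⟨Ā, hĀlo, hĀhi⟩ := exists_between hLU₁
    have hĀpos : 0 < Ā := by linarith
    refine twoPoint_memory_blowup hρ0 hρ1 hq hē ha hsrc hμ (hL1.le.trans hĀlo.le) ?_ ?_ ?_ hC hC0 hω D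
    · have := (lt_div_iff₀ hqē).mp hĀhi; linarith
    · have := (div_lt_iff₀ hqē).mp hĀlo; linarith
    · have h1 : Ā * ((1 - q * ē) - μ) ≤ 0 := by nlinarith
      linarith

/-! ### (5.3) At the primitive booking `ρ = (1 + ν)/2`: the clause `8·q·ē ≤ (1 − ν)²` is sharp in order -/

/-- THE BOOKED SIDE, RESTATED ON THE DATA: at `ρ = (1 + ν)/2`, for ANY memory class `Cω^{j−i}` with `(1 + C)ω ≤ ν`
(`C, ω ≥ 0`, `ν < 1`) and signs `a, p, q, ē ≥ 0`, the primitive clause `8·q·ē ≤ (1 − ν)²` gives the `K`-uniform bound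
`δ_j ≤ (4p/(1 − ν) + 8·q·a/(1 − ν)²)·ρ^j` (`gain_of_primitive` with `cr, ℓ′, γ := q, ē, 1`, `twoPoint_fixedPoint`,
`rateConst_le_primitive`).  This is the sufficiency the necessity results below are measured against. [folklore] -/
theorem twoPoint_bounded_at_primitive {K : ℕ} {δ s e : ℕ → ℝ} {M : ℕ → ℕ → ℝ} {a p q ē C ω ν : ℝ}
    (hν1 : ν < 1) (hC : 0 ≤ C) (hω : 0 ≤ ω) (hCων : (1 + C) * ω ≤ ν)
    (ha : 0 ≤ a) (hp : 0 ≤ p) (hq : 0 ≤ q) (hē : 0 ≤ ē) (hprim : 8 * q * ē ≤ (1 - ν) ^ 2)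
    (hdata : TwoPointData K δ s e M a p q ē C ω ((1 + ν) / 2)) :
    ∀ j, j ≤ K → δ j ≤ (4 * p / (1 - ν) + 8 * q * a / (1 - ν) ^ 2) * ((1 + ν) / 2) ^ j := by
  have hg := gain_of_primitive (cr := q) (ℓ' := ē) (γ := 1) hq hē zero_le_one hC hω hν1 hCων (by simpa using hprim)
  obtain ⟨hsmall, hρ1, hgain⟩ := hg
  have hgain' : q * ē * (((1 + ν) / 2 - ω) / ((1 + ν) / 2 - (1 + C) * ω)) ≤ (1 - (1 + ν) / 2) / 2 := by
    simpa using hgain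
  have h := twoPoint_fixedPoint_of_data hρ1 hω hC hsmall ha hp hq hē hdata hgain'
  have hCω : 0 ≤ C * ω := mul_nonneg hC hω
  have hν0' : 0 ≤ (1 + ν) / 2 := by nlinarith [hCων, hCω, hω]
  have h1ν : 0 < 1 - ν := by linarith
  -- the constant: 2(p + qaκ)/(1−ρ) = 4p/(1−ν) + 2(q(aκ'))/(1−ρ) ≤ 4p/(1−ν) + 8qa/(1−ν)²
  have hrate := rateConst_le_primitive (cr := q) hq ha hC hω hν1 hCων
  have e0 : 1 - (1 + ν) / 2 = (1 - ν) / 2 := by ring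
  have hconst : 2 * (p + q * a * (((1 + ν) / 2 - ω) / ((1 + ν) / 2 - (1 + C) * ω))) / (1 - (1 + ν) / 2)
      ≤ 4 * p / (1 - ν) + 8 * q * a / (1 - ν) ^ 2 := by
    have esplit : 2 * (p + q * a * (((1 + ν) / 2 - ω) / ((1 + ν) / 2 - (1 + C) * ω))) / (1 - (1 + ν) / 2)
        = 4 * p / (1 - ν)
          + 2 * (q * (a * ((1 + ν) / 2 - ω) / ((1 + ν) / 2 - (1 + C) * ω))) / (1 - (1 + ν) / 2) := by
      rw [e0, div_div_eq_mul_div, div_div_eq_mul_div]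
      ring
    rw [esplit]
    exact add_le_add le_rfl hrate
  intro j hj
  exact (h j hj).trans (mul_le_mul_of_nonneg_right hconst (pow_nonneg hν0' j))

/-- The saturating memory class used by the necessity family: for `0 < ω < ν`, `C := (ν − ω)/ω ≥ 0` has
`(1 + C)·ω = ν` — inside the booked class `(1 + C′)ω ≤ ν`, with the gap `(1 + C)ω < (1 + ν)/2` whenever `ν < 1`.
[folklore] -/
theorem saturatingClass {ν ω : ℝ} (hω0 : 0 < ω) (hων : ω < ν) (hν1 : ν < 1) :
    0 ≤ (ν - ω) / ω ∧ (1 + (ν - ω) / ω) * ω = ν ∧ (1 + (ν - ω) / ω) * ω < (1 + ν) / 2 := by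
  have e : (1 + (ν - ω) / ω) * ω = ν := by field_simp; ring
  exact ⟨div_nonneg (by linarith) hω0.le, e, by rw [e]; linarith⟩

/-- **NO K-UNIFORM CONSTANT AT THE PRIMITIVE BOOKING ONCE `2·q·ē ≥ (1 − ν)²` (sharpness of §3's clause in ORDER).**
`0 < ν < 1`, `ρ = (1 + ν)/2`, `q, ē > 0`, source `p + q·a > 0`, and a memory class saturating the injected rate:
`C = (ν − ω)/ω` with `0 < ω`, `2ω < ν(1 − ν)²` (so `(1 + C)ω = ν`, `saturatingClass`).  If `2·q·ē ≥ (1 − ν)²` then for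
every `D` some data satisfying `TwoPointData` at these parameters have `δ_0 > D`.  Proof: if `q·ē ≥ (1 − ν)/2` the
memoryless resonant family (`twoPoint_window_necessary`); otherwise the lag-one family of mass `μ = ν − ω = Cω`
(`twoPoint_memory_window_necessary`), whose blow-up condition `(1 − u)((1 − ν)/2 − u) < (1 − ν)(ν − ω)/2`,
`u = q·ē ∈ [(1 − ν)²/2, (1 − ν)/2)`, follows from its value at `u = (1 − ν)²/2` and `ω < ν(1 − ν)²/2`.  Against
`twoPoint_bounded_at_primitive` (`8·q·ē ≤ (1 − ν)²` suffices for EVERY class `(1 + C′)ω ≤ ν`): the primitive window is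
sharp in type and in order `(1 − ν)²`, up to the factor 4.  ABSTRACT data; not realised as runs of (0.20).
[folklore] -/
theorem primitiveWindow_necessary {a p q ē ν ω : ℝ} (hν1 : ν < 1) (hq : 0 < q) (hē : 0 < ē)
    (ha : 0 ≤ a) (hsrc : 0 < p + q * a) (hu : (1 - ν) ^ 2 ≤ 2 * q * ē)
    (hω0 : 0 < ω) (hω1 : 2 * ω < ν * (1 - ν) ^ 2) (D : ℝ) :
    ∃ (K : ℕ) (δ s e : ℕ → ℝ) (M : ℕ → ℕ → ℝ),
      TwoPointData K δ s e M a p q ē ((ν - ω) / ω) ω ((1 + ν) / 2) ∧ D < δ 0 := by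
  have h1ν : 0 < 1 - ν := by linarith
  have hν0 : 0 < ν := by
    by_contra h
    rw [not_lt] at h
    nlinarith [mul_nonneg (neg_nonneg.mpr h) (sq_nonneg (1 - ν))]
  have hsq1 : (1 - ν) ^ 2 ≤ 1 := by nlinarith
  have hων : ω < ν := by nlinarith [mul_le_mul_of_nonneg_left hsq1 hν0.le]
  have hC0 : 0 ≤ (ν - ω) / ω := div_nonneg (by linarith) hω0.le
  have hρ0 : 0 < (1 + ν) / 2 := by linarith
  have hρ1 : (1 + ν) / 2 < 1 := by linarith
  have hqē : 0 < q * ē := mul_pos hq hē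
  by_cases hcase : 1 - (1 + ν) / 2 ≤ q * ē
  · -- memoryless resonant family
    exact twoPoint_window_necessary hρ0 hρ1 hq ha hsrc (by rw [div_le_iff₀ hq]; linarith) hC0 hω0.le D
  · rw [not_le] at hcase
    have hμC : ν - ω ≤ (ν - ω) / ω * ω := by field_simp; exact le_rfl
    refine twoPoint_memory_window_necessary (μ := ν - ω) hρ0 hρ1 hq hē ha hsrc (by linarith) hcase ?_ hμC hC0
      hω0.le D
    -- (1 − u)((1−ν)/2 − u) ≤ (1 − u₀)((1−ν)/2 − u₀) = (1 − (1−ν)²/2)·((1−ν)/2)·ν < ((1−ν)/2)(ν − ω)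
    have hu' : (1 - ν) ^ 2 / 2 ≤ q * ē := by linarith
    have hmono : (1 - q * ē) * ((1 - (1 + ν) / 2) - q * ē)
        ≤ (1 - (1 - ν) ^ 2 / 2) * ((1 - (1 + ν) / 2) - (1 - ν) ^ 2 / 2) := by
      have hA : 0 ≤ q * ē - (1 - ν) ^ 2 / 2 := by linarith
      have hB : 0 ≤ 1 + (1 - (1 + ν) / 2) - q * ē - (1 - ν) ^ 2 / 2 := by nlinarith
      nlinarith [mul_nonneg hA hB]
    have hval : (1 - (1 - ν) ^ 2 / 2) * ((1 - (1 + ν) / 2) - (1 - ν) ^ 2 / 2)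
        = (1 - (1 - ν) ^ 2 / 2) * ν * ((1 - ν) / 2) := by ring
    have hlt : (1 - (1 - ν) ^ 2 / 2) * ν * ((1 - ν) / 2) < (1 - (1 + ν) / 2) * (ν - ω) := by
      have e0 : 1 - (1 + ν) / 2 = (1 - ν) / 2 := by ring
      rw [e0]
      have hkey : (1 - (1 - ν) ^ 2 / 2) * ν < ν - ω := by nlinarith
      nlinarith [hkey, h1ν]
    linarith [hmono, hval, hlt]

/-- The same, as the NEGATION OF A UNIFORM CONSTANT: at `ρ = (1 + ν)/2` with the saturating class of
`primitiveWindow_necessary` and `2·q·ē ≥ (1 − ν)²`, no `Cst` bounds `δ_j ≤ Cst·ρ^j` (`j ≤ K`) for all data satisfying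
`TwoPointData` — whereas under `8·q·ē ≤ (1 − ν)²` the constant `4p/(1 − ν) + 8qa/(1 − ν)²` does
(`twoPoint_bounded_at_primitive`). [folklore] -/
theorem no_uniform_constant_at_primitive {a p q ē ν ω : ℝ} (hν1 : ν < 1) (hq : 0 < q) (hē : 0 < ē)
    (ha : 0 ≤ a) (hsrc : 0 < p + q * a) (hu : (1 - ν) ^ 2 ≤ 2 * q * ē)
    (hω0 : 0 < ω) (hω1 : 2 * ω < ν * (1 - ν) ^ 2) :
    ¬ ∃ Cst : ℝ, ∀ (K : ℕ) (δ s e : ℕ → ℝ) (M : ℕ → ℕ → ℝ),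
        TwoPointData K δ s e M a p q ē ((ν - ω) / ω) ω ((1 + ν) / 2) →
          ∀ j, j ≤ K → δ j ≤ Cst * ((1 + ν) / 2) ^ j := by
  rintro ⟨Cst, hCst⟩
  obtain ⟨K, δ, s, e, M, hdata, hD⟩ := primitiveWindow_necessary hν1 hq hē ha hsrc hu hω0 hω1 Cst
  have h := hCst K δ s e M hdata 0 (Nat.zero_le K)
  simp at h
  linarith

/-- CELL-CURRENCY READING (records only).  With `q = cr` (read-out Lipschitz constant) and `ē = ℓ′γ³` (the weight
bound of §2 / `T4TwoRunMatching` §3), the memoryless threshold is `cr·ℓ′·γ³ = 1 − ρ` and, at the primitive booking with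
memory saturating `ν`, no `K`-uniform matching constant survives `2·cr·ℓ′·γ³ ≥ (1 − ν)²` while `8·cr·ℓ′·γ³ ≤ (1 − ν)²`
suffices: §3's clause is the loop-gain window of `twoPoint_fixedPoint` and is intrinsic to node U2's two-point
system, in TYPE (a coupling window, cubic in the box size at fixed `cr·ℓ′`) and in ORDER in the gap.  This theorem is
the trivial currency substitution, recorded so that the cell's records can cite ONE declaration. [folklore] -/
theorem primitiveWindow_necessary_currency {a p cr ℓ' γ ν ω : ℝ} (hν1 : ν < 1) (hcr : 0 < cr) (hℓ' : 0 < ℓ')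
    (hγ : 0 < γ) (ha : 0 ≤ a) (hsrc : 0 < p + cr * a) (hu : (1 - ν) ^ 2 ≤ 2 * cr * (ℓ' * γ ^ 3))
    (hω0 : 0 < ω) (hω1 : 2 * ω < ν * (1 - ν) ^ 2) (D : ℝ) :
    ∃ (K : ℕ) (δ s e : ℕ → ℝ) (M : ℕ → ℕ → ℝ),
      TwoPointData K δ s e M a p cr (ℓ' * γ ^ 3) ((ν - ω) / ω) ω ((1 + ν) / 2) ∧ D < δ 0 :=
  primitiveWindow_necessary hν1 hcr (by positivity) ha hsrc hu hω0 hω1 D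

end Sharpness

/-! ## §6 The AF form — SUMMABLE read-out weights: the loop-gain window moves from the TARGET gap to the MEMORY gap

§5 showed that for weights constrained only by a SUP bound `e_j ≤ ē` the window `q·ē·κ ≤ (1 − ρ)/2` of
`twoPoint_fixedPoint` cannot be dropped (`twoPoint_window_necessary`: weights SATURATING `ē` along the whole run,
`Σ_{j<K} e_j = K·ē`).  The complementary positive statement, recorded here, is that a bound on the SUM of the weights,
`Σ_{j<K} e_j ≤ U` (K-uniform), replaces that window by `q·U ≤ (1 − (1 + C)ω)/2` — a smallness against the MEMORY rate
`(1 + C)ω`, NOT against the target rate `ρ`; the conclusion and its constant `2(p + qaκ)(1 − ρ)⁻¹` are unchanged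
(`twoPoint_fixedPoint_summable`).  Proof: the exact resolvent of the memory (`T4BetaMemorySharp.renewal_le`, rate
`(1 + C)ω`) turns the loop forcing `e_jδ_j` into the forward state `acc ((1+C)ω) (e·δ) (j+1)`; summed backward from the
pin, `(1 − (1+C)ω)·Σ_{i∈[j,K)} acc (i+1) ≤ (1+C)ω·acc j + Σ_{i∈[j,K)} e_iδ_i ≤ D·U·ρ^j` (`acc_Ico_sum_le`) with the
weighted maximum `D = max δ_i ρ^{−i}`, and the absorption is against `1 − (1 + C)ω`.

At run level the weights are `e_j = ℓ′(g^A_j)²g^B_{j+1}` and their sum along two runs of (0.20) is K-UNIFORMLY bounded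
on the asymptotic-freedom branch — `T4CouplingMatching.sum_weights_le_of_eventualLower`: `Σ_{i≤K} (g^A_i)²g^B_{i+1} ≤
(k₀ + 1)γ³ + 2γ/b` under `EventualLowerH b γ k₀ β` (UNPRINTED input, the (AF-0r)/tail-lower shape).  Hence
(`disc_le_of_twoRun_af`, `injectedRate_of_fullScheme_twoRun_af`): the conclusion of `injectedRate_of_fullScheme_twoRun`
(= that of `T4FlagMemory.injectedRate_of_scheme`, literally) holds from `T4FlagMemory.injectedRate_of_scheme`'s OWN
hypothesis list with its window `cr·ℓ′·((k₀+1)γ³ + 2γ/b) ≤ (1 − ρ)/2` WEAKENED to `cr·ℓ′·((k₀+1)γ³ + 2γ/b) ≤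
(1 − (1 + C′)ω)/2` — independent of the target rate ρ ∈ ((1 + C′)ω, 1) (so rates ρ ↑ 1 cost nothing in the window), and
at the primitive booking `ρ = (1 + ν)/2` the window carries NO factor of `(1 − ν)` at all
(`injectedRate_of_fullScheme_primitive_af`; contrast §3's `8·cr·ℓ′γ³ ≤ (1 − ν)²`, sharp WITHOUT weight summability
by §5).
READING (node U2, booking sheet I7): the dividing line drawn by §5 and §6 together is weight summability — with the AF
weight sum (the box-uniform closure's `EventualLowerH` input) the closure window is against the memory gap only (and for
last-coordinate-only feedback none is needed beyond `Lγ³ ≤ ½`: `T4CouplingMatching.disc_le_of_lastOnly` /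
`injectedRate_of_runs_lastOnly`, Grönwall product form, lineage pv16); without it (no β lower bound inside the matching,
§2/§3) the window against the target gap is intrinsic.  Elementary real analysis; every hypothesis about Bałaban's
objects remains an UNPRINTED input exactly as in §§2–3; nothing of [I]–[III] is asserted; rung (B)+1 finite T⁴
bookkeeping; NOT summit progress. -/

section Summable

open Literature.MathematicalPhysics.QuantumFieldTheory.Balaban1983to89.T4BetaMemorySharp (acc acc_zero acc_succ
  renewal_le)

/-- `acc t W n ≥ 0` for `t ≥ 0`, `W ≥ 0`. [folklore] -/
theorem acc_nonneg_of_nonneg {t : ℝ} {W : ℕ → ℝ} (ht : 0 ≤ t) (hW : ∀ m, 0 ≤ W m) (n : ℕ) : 0 ≤ acc t W n :=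
  Finset.sum_nonneg fun m _ => mul_nonneg (pow_nonneg ht _) (hW m)

/-- The accumulated geometric forcing: `acc t (ρ^·) n ≤ ρ^n/(ρ − t)` for `0 ≤ t < ρ` (induction on `acc_succ`).
[folklore] -/
theorem acc_geom_le {t ρ : ℝ} (ht : 0 ≤ t) (htρ : t < ρ) : ∀ n, acc t (fun m => ρ ^ m) n ≤ ρ ^ n / (ρ - t) := by
  have hρt : 0 < ρ - t := sub_pos.mpr htρ
  intro n
  induction n with
  | zero => rw [acc_zero, pow_zero]; exact div_nonneg zero_le_one hρt.le
  | succ n ih =>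
    rw [acc_succ]
    have h1 : t * acc t (fun m => ρ ^ m) n ≤ t * (ρ ^ n / (ρ - t)) := mul_le_mul_of_nonneg_left ih ht
    have key : t * (ρ ^ n / (ρ - t)) + ρ ^ n = ρ ^ (n + 1) / (ρ - t) := by
      rw [pow_succ]
      field_simp
      ring
    linarith [key]

/-- PARTIAL SUMS OF THE FORWARD STATE (the one summation-by-parts of §6): for `0 ≤ t`, `W ≥ 0`, `j ≤ K`,
`(1 − t)·Σ_{i∈[j,K)} acc t W (i+1) ≤ t·acc t W j + Σ_{i∈[j,K)} W i` — indeed with `+ t·acc t W K` on the left it is an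
identity (induction on K with `acc_succ`). [folklore] -/
theorem acc_Ico_sum_le {t : ℝ} {W : ℕ → ℝ} (ht : 0 ≤ t) (hW : ∀ m, 0 ≤ W m) {j K : ℕ} (hjK : j ≤ K) :
    (1 - t) * ∑ i ∈ Ico j K, acc t W (i + 1) ≤ t * acc t W j + ∑ i ∈ Ico j K, W i := by
  have inv : ∀ K', j ≤ K' →
      (1 - t) * ∑ i ∈ Ico j K', acc t W (i + 1) + t * acc t W K' = t * acc t W j + ∑ i ∈ Ico j K', W i := by
    intro K' hK'
    induction K', hK' using Nat.le_induction with
    | base => simp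
    | succ n hn ih =>
      rw [Finset.sum_Ico_succ_top hn, Finset.sum_Ico_succ_top hn, acc_succ t W n]
      linear_combination ih
  have h := inv K hjK
  have h0 : 0 ≤ t * acc t W K := mul_nonneg ht (acc_nonneg_of_nonneg ht hW K)
  linarith

/-- **THE TWO-POINT FIXED POINT, AF FORM (summable read-out weights).**  As `T4TwoRunMatching.twoPoint_fixedPoint`
(`δ ≥ 0` pinned `δ_K = 0` with the backward step `δ_j ≤ δ_{j+1} + pρ^j + q·s_j`; `s_j ≥ 0` with the forward renewal
`s_j ≤ aρ^j + e_j·δ_j + Σ_{i<j} M_{j,i}s_i`, memory `0 ≤ M_{j,i} ≤ Cω^{j−i}`, gap `(1 + C)ω < ρ < 1`), but with the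
weight hypothesis `0 ≤ e_j ≤ ē` + window `q·ē·κ ≤ (1 − ρ)/2` REPLACED by `0 ≤ e_j`, `Σ_{j<K} e_j ≤ U` and the smallness
`q·U ≤ (1 − (1 + C)ω)/2` — against the MEMORY rate, not the target rate.  SAME conclusion
`δ_j ≤ 2(p + qaκ)(1 − ρ)⁻¹ρ^j` (`j ≤ K`, `κ = (ρ − ω)/(ρ − (1 + C)ω)`), and `s_j ≤ (aκ + U·2(p + qaκ)(1 − ρ)⁻¹)ρ^j`
(`j < K`).  Constants free of `K`. [folklore] -/
theorem twoPoint_fixedPoint_summable {K : ℕ} {δ s e : ℕ → ℝ} {M : ℕ → ℕ → ℝ} {a p q U C ω ρ : ℝ}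
    (hρ1 : ρ < 1) (hω : 0 ≤ ω) (hC : 0 ≤ C) (hsmall : (1 + C) * ω < ρ)
    (ha : 0 ≤ a) (hp : 0 ≤ p) (hq : 0 ≤ q)
    (hδ : ∀ j, 0 ≤ δ j) (hs : ∀ j, j < K → 0 ≤ s j) (he : ∀ j, j < K → 0 ≤ e j)
    (hU : ∑ j ∈ range K, e j ≤ U)
    (hM : ∀ j i, i < j → 0 ≤ M j i ∧ M j i ≤ C * ω ^ (j - i))
    (hK : δ K = 0)
    (hback : ∀ j, j < K → δ j ≤ δ (j + 1) + p * ρ ^ j + q * s j)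
    (hfwd : ∀ j, j < K → s j ≤ a * ρ ^ j + e j * δ j + ∑ i ∈ range j, M j i * s i)
    (hwin : q * U ≤ (1 - (1 + C) * ω) / 2) :
    (∀ j, j ≤ K → δ j ≤ 2 * (p + q * a * ((ρ - ω) / (ρ - (1 + C) * ω))) / (1 - ρ) * ρ ^ j) ∧
    (∀ j, j < K → s j ≤ (a * ((ρ - ω) / (ρ - (1 + C) * ω))
        + U * (2 * (p + q * a * ((ρ - ω) / (ρ - (1 + C) * ω))) / (1 - ρ))) * ρ ^ j) := by
  set κ := (ρ - ω) / (ρ - (1 + C) * ω) with hκ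
  have ht0 : 0 ≤ (1 + C) * ω := by positivity
  have hρ0 : 0 < ρ := lt_of_le_of_lt ht0 hsmall
  have ht1 : (1 + C) * ω < 1 := hsmall.trans hρ1
  have h1t : 0 < 1 - (1 + C) * ω := sub_pos.mpr ht1
  have hωt : ω ≤ (1 + C) * ω := by nlinarith
  have hCωt : C * ω ≤ (1 + C) * ω := by nlinarith
  have hωρ : ω < ρ := lt_of_le_of_lt hωt hsmall
  have hden : 0 < ρ - (1 + C) * ω := sub_pos.mpr hsmall
  have hκ0 : 0 ≤ κ := div_nonneg (sub_pos.mpr hωρ).le hden.le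
  have h1ρ : 0 < 1 - ρ := sub_pos.mpr hρ1
  have hU0 : 0 ≤ U := (Finset.sum_nonneg fun j hj => he j (mem_range.mp hj)).trans hU
  -- the weighted maximum of δ over j ≤ K
  have hne : (range (K + 1)).Nonempty := ⟨0, by simp⟩
  set D := (range (K + 1)).sup' hne (fun i => δ i / ρ ^ i) with hD
  have hDi : ∀ i, i ≤ K → δ i ≤ D * ρ ^ i := by
    intro i hi
    have h : δ i / ρ ^ i ≤ D :=
      Finset.le_sup' (fun i => δ i / ρ ^ i) (Finset.mem_range.mpr (Nat.lt_succ_of_le hi))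
    rwa [div_le_iff₀ (pow_pos hρ0 i)] at h
  have hD0 : 0 ≤ D := by
    have h : δ 0 / ρ ^ 0 ≤ D :=
      Finset.le_sup' (fun i => δ i / ρ ^ i) (Finset.mem_range.mpr (Nat.succ_pos K))
    have : (0 : ℝ) ≤ δ 0 / ρ ^ 0 := by simpa using hδ 0
    exact this.trans h
  -- the loop forcing W_m = e_m δ_m (truncated at K) and its bounds
  set W : ℕ → ℝ := fun m => if m < K then e m * δ m else 0 with hW
  have hWK : ∀ m, m < K → W m = e m * δ m := fun m hm => by simp [hW, hm]
  have hW0 : ∀ m, 0 ≤ W m := by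
    intro m
    by_cases hm : m < K
    · rw [hWK m hm]; exact mul_nonneg (he m hm) (hδ m)
    · simp [hW, hm]
  have hWle : ∀ m, m < K → W m ≤ e m * (D * ρ ^ m) := fun m hm => by
    rw [hWK m hm]; exact mul_le_mul_of_nonneg_left (hDi m hm.le) (he m hm)
  have hWρ : ∀ n m, m < K → m ≤ n → ((1 + C) * ω) ^ (n - m) * W m ≤ D * ρ ^ n * e m := by
    intro n m hmK hmn
    have h1 : ((1 + C) * ω) ^ (n - m) ≤ ρ ^ (n - m) := pow_le_pow_left₀ ht0 hsmall.le _
    calc ((1 + C) * ω) ^ (n - m) * W m ≤ ρ ^ (n - m) * (e m * (D * ρ ^ m)) :=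
          mul_le_mul h1 (hWle m hmK) (hW0 m) (pow_nonneg hρ0.le _)
      _ = D * (ρ ^ (n - m) * ρ ^ m) * e m := by ring
      _ = D * ρ ^ n * e m := by rw [← pow_add, Nat.sub_add_cancel hmn]
  have htacc : ∀ n, (1 + C) * ω * acc ((1 + C) * ω) W n = ∑ m ∈ range n, ((1 + C) * ω) ^ (n - m) * W m := by
    intro n
    rw [acc, Finset.mul_sum]
    refine Finset.sum_congr rfl fun m hm => ?_
    have hm' := mem_range.mp hm
    rw [show n - m = (n - 1 - m) + 1 by omega, pow_succ]
    ring
  have hacc1 : ∀ n, acc ((1 + C) * ω) W (n + 1) = ∑ m ∈ range (n + 1), ((1 + C) * ω) ^ (n - m) * W m := by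
    intro n
    rw [acc]
    refine Finset.sum_congr rfl fun m _ => ?_
    rw [Nat.add_sub_cancel]
  have hsumW : ∀ n, n ≤ K →
      ∑ m ∈ range n, ((1 + C) * ω) ^ (n - m) * W m ≤ D * ρ ^ n * ∑ m ∈ range n, e m := by
    intro n hn
    rw [Finset.mul_sum]
    exact Finset.sum_le_sum fun m hm =>
      hWρ n m (lt_of_lt_of_le (mem_range.mp hm) hn) (mem_range.mp hm).le
  have hIcoW : ∀ j, j ≤ K → ∑ i ∈ Ico j K, W i ≤ D * ρ ^ j * ∑ i ∈ Ico j K, e i := by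
    intro j hj
    rw [Finset.mul_sum]
    refine Finset.sum_le_sum fun i hi => ?_
    obtain ⟨hji, hiK⟩ := Finset.mem_Ico.mp hi
    have h1 : ρ ^ i ≤ ρ ^ j := pow_le_pow_of_le_one hρ0.le hρ1.le hji
    calc W i ≤ e i * (D * ρ ^ i) := hWle i hiK
      _ ≤ e i * (D * ρ ^ j) := mul_le_mul_of_nonneg_left (mul_le_mul_of_nonneg_left h1 hD0) (he i hiK)
      _ = D * ρ ^ j * e i := by ring
  have hsplitU : ∀ j, j ≤ K → ∑ m ∈ range j, e m + ∑ i ∈ Ico j K, e i = ∑ m ∈ range K, e m := by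
    intro j hj
    rw [Finset.range_eq_Ico, Finset.range_eq_Ico]
    exact Finset.sum_Ico_consecutive e (Nat.zero_le j) hj
  -- Step 1: the exact resolvent of the memory applied to the truncated bracket discrepancies
  set s' : ℕ → ℝ := fun j => if j < K then s j else 0 with hs'
  have hs'K : ∀ j, j < K → s' j = s j := fun j hj => by simp [hs', hj]
  have hs'0 : ∀ j, 0 ≤ s' j := by
    intro j
    by_cases hj : j < K
    · rw [hs'K j hj]; exact hs j hj
    · simp [hs', hj]
  have hren : ∀ n, s' n ≤ (fun m => a * ρ ^ m + W m) n + C * ω * acc ω s' n := by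
    intro n
    have hacc0 : 0 ≤ acc ω s' n := acc_nonneg_of_nonneg hω hs'0 n
    have hf0 : 0 ≤ a * ρ ^ n + W n := add_nonneg (mul_nonneg ha (pow_nonneg hρ0.le n)) (hW0 n)
    by_cases hn : n < K
    · rw [hs'K n hn]
      have h1 := hfwd n hn
      have h2 : ∑ i ∈ range n, M n i * s i ≤ C * ω * acc ω s' n := by
        rw [acc, Finset.mul_sum]
        refine Finset.sum_le_sum fun i hi => ?_
        have hi' : i < n := mem_range.mp hi
        rw [hs'K i (hi'.trans hn)]
        calc M n i * s i ≤ C * ω ^ (n - i) * s i :=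
              mul_le_mul_of_nonneg_right (hM n i hi').2 (hs i (hi'.trans hn))
          _ = C * ω * (ω ^ (n - 1 - i) * s i) := by
              rw [show n - i = (n - 1 - i) + 1 by omega, pow_succ]; ring
      have h3 : e n * δ n = W n := (hWK n hn).symm
      show s n ≤ (a * ρ ^ n + W n) + C * ω * acc ω s' n
      linarith [h2, h3]
    · have h4 : s' n = 0 := by simp [hs', hn]
      rw [h4]
      show (0 : ℝ) ≤ (a * ρ ^ n + W n) + C * ω * acc ω s' n
      have : 0 ≤ C * ω * acc ω s' n := mul_nonneg (mul_nonneg hC hω) hacc0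
      linarith
  have hres := renewal_le hω (mul_nonneg hC hω) hren
  have e1 : ω + C * ω = (1 + C) * ω := by ring
  have hsplit : ∀ n, acc ((1 + C) * ω) (fun m => a * ρ ^ m + W m) n
      = a * acc ((1 + C) * ω) (fun m => ρ ^ m) n + acc ((1 + C) * ω) W n := by
    intro n
    simp only [acc, Finset.mul_sum, ← Finset.sum_add_distrib]
    exact Finset.sum_congr rfl fun m _ => by ring
  have hsrc : ∀ n, a * ρ ^ n + C * ω * (a * acc ((1 + C) * ω) (fun m => ρ ^ m) n) ≤ a * κ * ρ ^ n := by
    intro n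
    have h1 := acc_geom_le ht0 hsmall n
    have h2 : C * ω * (a * acc ((1 + C) * ω) (fun m => ρ ^ m) n) ≤ C * ω * (a * (ρ ^ n / (ρ - (1 + C) * ω))) :=
      mul_le_mul_of_nonneg_left (mul_le_mul_of_nonneg_left h1 ha) (mul_nonneg hC hω)
    have hne' : ρ - (1 + C) * ω ≠ 0 := hden.ne'
    have hu : ρ ^ n / (ρ - (1 + C) * ω) * (ρ - (1 + C) * ω) = ρ ^ n := div_mul_cancel₀ _ hne'
    have hκd : κ * (ρ - (1 + C) * ω) = ρ - ω := by rw [hκ]; exact div_mul_cancel₀ _ hne'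
    have key : a * ρ ^ n + C * ω * (a * (ρ ^ n / (ρ - (1 + C) * ω))) = a * κ * ρ ^ n := by
      linear_combination (a * κ - a) * hu - (a * (ρ ^ n / (ρ - (1 + C) * ω))) * hκd
    linarith [key]
  have hloop : ∀ n, W n + C * ω * acc ((1 + C) * ω) W n ≤ acc ((1 + C) * ω) W (n + 1) := by
    intro n
    rw [acc_succ]
    have := mul_le_mul_of_nonneg_right hCωt (acc_nonneg_of_nonneg ht0 hW0 n)
    linarith
  have hsn : ∀ n, n < K → s n ≤ a * κ * ρ ^ n + acc ((1 + C) * ω) W (n + 1) := by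
    intro n hn
    have h := hres n
    rw [hs'K n hn, e1, hsplit n] at h
    have h' : s n ≤ (a * ρ ^ n + W n)
        + C * ω * (a * acc ((1 + C) * ω) (fun m => ρ ^ m) n + acc ((1 + C) * ω) W n) := h
    have e2 : (a * ρ ^ n + W n) + C * ω * (a * acc ((1 + C) * ω) (fun m => ρ ^ m) n + acc ((1 + C) * ω) W n)
        = (a * ρ ^ n + C * ω * (a * acc ((1 + C) * ω) (fun m => ρ ^ m) n))
          + (W n + C * ω * acc ((1 + C) * ω) W n) := by ring
    linarith [hsrc n, hloop n, e2]
  -- Step 2: backward accumulation from the pin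
  have hc0 : 0 ≤ p + q * (a * κ) := by positivity
  have hback' : ∀ j, j < K →
      δ j ≤ δ (j + 1) + ((p + q * (a * κ)) * ρ ^ j + q * acc ((1 + C) * ω) W (j + 1)) := by
    intro j hj
    have h1 := hback j hj
    have h2 : q * s j ≤ q * (a * κ * ρ ^ j + acc ((1 + C) * ω) W (j + 1)) :=
      mul_le_mul_of_nonneg_left (hsn j hj) hq
    have e3 : q * (a * κ * ρ ^ j + acc ((1 + C) * ω) W (j + 1))
        = q * (a * κ) * ρ ^ j + q * acc ((1 + C) * ω) W (j + 1) := by ring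
    have e4 : δ (j + 1) + ((p + q * (a * κ)) * ρ ^ j + q * acc ((1 + C) * ω) W (j + 1))
        = δ (j + 1) + p * ρ ^ j + (q * (a * κ) * ρ ^ j + q * acc ((1 + C) * ω) W (j + 1)) := by ring
    linarith [e3, e4]
  have hδsum := backward_sum (le_of_eq hK) hback'
  have hδb : ∀ j, j ≤ K →
      δ j ≤ ((p + q * (a * κ)) / (1 - ρ) + q * U * D / (1 - (1 + C) * ω)) * ρ ^ j := by
    intro j hj
    have h1 := hδsum j hj
    rw [Finset.sum_add_distrib, ← Finset.mul_sum, ← Finset.mul_sum] at h1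
    have hgeo : ∑ i ∈ Ico j K, ρ ^ i ≤ ρ ^ j / (1 - ρ) := geom_sum_Ico_le_of_lt_one hρ0.le hρ1
    have hS := acc_Ico_sum_le ht0 hW0 hj
    have hA : (1 + C) * ω * acc ((1 + C) * ω) W j ≤ D * ρ ^ j * ∑ m ∈ range j, e m := by
      rw [htacc]; exact hsumW j hj
    have hB := hIcoW j hj
    have hsumU : D * ρ ^ j * ∑ m ∈ range j, e m + D * ρ ^ j * ∑ i ∈ Ico j K, e i ≤ D * ρ ^ j * U := by
      rw [← mul_add, hsplitU j hj]
      exact mul_le_mul_of_nonneg_left hU (mul_nonneg hD0 (pow_nonneg hρ0.le j))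
    have hS1 : (1 - (1 + C) * ω) * ∑ i ∈ Ico j K, acc ((1 + C) * ω) W (i + 1) ≤ D * ρ ^ j * U := by
      linarith [hS, hA, hB, hsumU]
    have hS' : ∑ i ∈ Ico j K, acc ((1 + C) * ω) W (i + 1) ≤ D * ρ ^ j * U / (1 - (1 + C) * ω) := by
      rw [le_div_iff₀' h1t]
      exact hS1
    calc δ j ≤ (p + q * (a * κ)) * ∑ i ∈ Ico j K, ρ ^ i + q * ∑ i ∈ Ico j K, acc ((1 + C) * ω) W (i + 1) := h1
      _ ≤ (p + q * (a * κ)) * (ρ ^ j / (1 - ρ)) + q * (D * ρ ^ j * U / (1 - (1 + C) * ω)) :=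
          add_le_add (mul_le_mul_of_nonneg_left hgeo hc0) (mul_le_mul_of_nonneg_left hS' hq)
      _ = ((p + q * (a * κ)) / (1 - ρ) + q * U * D / (1 - (1 + C) * ω)) * ρ ^ j := by ring
  -- Step 3: absorption at the maximiser, against the MEMORY gap `1 − (1 + C)ω`
  obtain ⟨i₀, hi₀, hDi₀⟩ := Finset.exists_mem_eq_sup' hne (fun i => δ i / ρ ^ i)
  have hi₀K : i₀ ≤ K := Nat.lt_succ_iff.mp (Finset.mem_range.mp hi₀)
  have hDle : D ≤ (p + q * (a * κ)) / (1 - ρ) + q * U * D / (1 - (1 + C) * ω) := by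
    calc D = δ i₀ / ρ ^ i₀ := hDi₀
      _ ≤ (p + q * (a * κ)) / (1 - ρ) + q * U * D / (1 - (1 + C) * ω) := by
          rw [div_le_iff₀ (pow_pos hρ0 i₀)]
          exact hδb i₀ hi₀K
  have hhalf : q * U * D / (1 - (1 + C) * ω) ≤ D / 2 := by
    rw [div_le_iff₀ h1t]
    have h := mul_le_mul_of_nonneg_right hwin hD0
    have e5 : (1 - (1 + C) * ω) / 2 * D = D / 2 * (1 - (1 + C) * ω) := by ring
    linarith [e5]
  have hD2 : D ≤ 2 * ((p + q * (a * κ)) / (1 - ρ)) := by linarith [hDle, hhalf]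
  -- Step 4: read off both bounds
  refine ⟨fun j hj => ?_, fun j hj => ?_⟩
  · calc δ j ≤ D * ρ ^ j := hDi j hj
      _ ≤ 2 * ((p + q * (a * κ)) / (1 - ρ)) * ρ ^ j := mul_le_mul_of_nonneg_right hD2 (pow_nonneg hρ0.le j)
      _ = 2 * (p + q * a * κ) / (1 - ρ) * ρ ^ j := by ring
  · have h1 := hsn j hj
    have h2 : acc ((1 + C) * ω) W (j + 1) ≤ D * ρ ^ j * ∑ m ∈ range (j + 1), e m := by
      rw [hacc1, Finset.mul_sum]
      exact Finset.sum_le_sum fun m hm =>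
        hWρ j m (lt_of_le_of_lt (Nat.lt_succ_iff.mp (mem_range.mp hm)) hj) (Nat.lt_succ_iff.mp (mem_range.mp hm))
    have h3 : ∑ m ∈ range (j + 1), e m ≤ U :=
      (Finset.sum_le_sum_of_subset_of_nonneg (Finset.range_mono (Nat.succ_le_of_lt hj))
        (fun i hi _ => he i (mem_range.mp hi))).trans hU
    have h4 : D * ρ ^ j * ∑ m ∈ range (j + 1), e m ≤ D * ρ ^ j * U :=
      mul_le_mul_of_nonneg_left h3 (mul_nonneg hD0 (pow_nonneg hρ0.le j))
    have h5 : D * ρ ^ j * U ≤ 2 * ((p + q * (a * κ)) / (1 - ρ)) * ρ ^ j * U :=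
      mul_le_mul_of_nonneg_right (mul_le_mul_of_nonneg_right hD2 (pow_nonneg hρ0.le j)) hU0
    calc s j ≤ a * κ * ρ ^ j + acc ((1 + C) * ω) W (j + 1) := h1
      _ ≤ a * κ * ρ ^ j + 2 * ((p + q * (a * κ)) / (1 - ρ)) * ρ ^ j * U := by linarith
      _ = (a * κ + U * (2 * (p + q * a * κ) / (1 - ρ))) * ρ ^ j := by ring

/-- The AF window is WEAKER than the target-gap window: under the gap `(1 + C′)ω < ρ`,
`x ≤ (1 − ρ)/2 → x ≤ (1 − (1 + C′)ω)/2`.  (So `injectedRate_of_fullScheme_twoRun_af` below applies whenever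
`T4FlagMemory.injectedRate_of_scheme` does, with the same conclusion.) [folklore] -/
theorem afWindow_of_targetWindow {x C' ω ρ : ℝ} (hsmall : (1 + C') * ω < ρ) (h : x ≤ (1 - ρ) / 2) :
    x ≤ (1 - (1 + C') * ω) / 2 := by
  linarith

variable {X : Type*} [PseudoMetricSpace X] [Inhabited X]

/-- **THE TWO-POINT SYSTEM WITH THE FULL MISMATCH READ OUT — AF FORM** (`disc_le_of_twoRun_full` with its window
`q·(ℓ′γ³)·κ ≤ (1 − ρ)/2` REPLACED by a bound `Σ_{i≤K} (g^A_i)²g^B_{i+1} ≤ U` on the SUM of the read-out weights and the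
smallness `q·ℓ′U ≤ (1 − (1 + C)ω)/2` against the MEMORY rate): two pinned runs of (0.20) in the box, the read-out
`betaMismatch β gA gB j ≤ q·s_j`, `TwoRunRenewal a ℓ′ ρ M gA gB s K` with `FadingMemory C ω M`, the gap
`(1 + C)ω < ρ < 1`; then `disc gA gB j ≤ 2qaκ(1 − ρ)⁻¹ρ^j` (j ≤ K) and `s_j ≤ (aκ + ℓ′U·2qaκ(1 − ρ)⁻¹)ρ^j` (j < K),
`κ = (ρ − ω)/(ρ − (1 + C)ω)`.  (`twoPoint_fixedPoint_summable` with `p = 0`, `e_j = ℓ′(g^A_j)²g^B_{j+1}` via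
`T4CouplingMatching.abs_sub_le_of_inv_sq` and the printed step `disc_step_twoRun`.) [folklore] -/
theorem disc_le_of_twoRun_af {β : HBeta} {K : ℕ} {gA gB s : ℕ → ℝ} {M : ℕ → ℕ → ℝ} {γ a ℓ' q C ω ρ U : ℝ}
    (hρ1 : ρ < 1) (hω : 0 ≤ ω) (hC : 0 ≤ C) (hsmall : (1 + C) * ω < ρ)
    (ha : 0 ≤ a) (hℓ' : 0 ≤ ℓ') (hq : 0 ≤ q)
    (hA : RGEqH K β gA) (hB : RGEqH (K + 1) β gB)
    (hAbox : ∀ i, i ≤ K → 0 < gA i ∧ gA i ≤ γ) (hBbox : ∀ i, i ≤ K + 1 → 0 < gB i ∧ gB i ≤ γ)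
    (hpin : gA K = gB (K + 1))
    (hread : ∀ j, j < K → betaMismatch β gA gB j ≤ q * s j)
    (hren : TwoRunRenewal a ℓ' ρ M gA gB s K) (hs : ∀ j, j < K → 0 ≤ s j) (hM : FadingMemory C ω M)
    (hU : ∑ i ∈ range (K + 1), (gA i) ^ 2 * gB (i + 1) ≤ U)
    (hwin : q * (ℓ' * U) ≤ (1 - (1 + C) * ω) / 2) :
    (∀ j, j ≤ K → disc gA gB j ≤ 2 * (q * a * ((ρ - ω) / (ρ - (1 + C) * ω))) / (1 - ρ) * ρ ^ j) ∧
    (∀ j, j < K → s j ≤ (a * ((ρ - ω) / (ρ - (1 + C) * ω))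
        + ℓ' * U * (2 * (q * a * ((ρ - ω) / (ρ - (1 + C) * ω))) / (1 - ρ))) * ρ ^ j) := by
  have he : ∀ j, j < K → 0 ≤ ℓ' * ((gA j) ^ 2 * gB (j + 1)) := fun j hj =>
    mul_nonneg hℓ' (mul_nonneg (sq_nonneg _) (hBbox (j + 1) (by omega)).1.le)
  have hU' : ∑ j ∈ range K, ℓ' * ((gA j) ^ 2 * gB (j + 1)) ≤ ℓ' * U := by
    rw [← Finset.mul_sum]
    refine mul_le_mul_of_nonneg_left (le_trans ?_ hU) hℓ'
    exact Finset.sum_le_sum_of_subset_of_nonneg (Finset.range_mono (Nat.le_succ K))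
      (fun i hi _ => mul_nonneg (sq_nonneg _) (hBbox (i + 1) (by have := mem_range.mp hi; omega)).1.le)
  have hback : ∀ j, j < K → disc gA gB j ≤ disc gA gB (j + 1) + 0 * ρ ^ j + q * s j := by
    intro j hj
    have h1 := disc_step_twoRun hA hB hj
    have h3 := hread j hj
    rw [zero_mul, add_zero]
    linarith
  have hfwd : ∀ j, j < K →
      s j ≤ a * ρ ^ j + ℓ' * ((gA j) ^ 2 * gB (j + 1)) * disc gA gB j + ∑ i ∈ range j, M j i * s i := by
    intro j hj
    have h1 := hren j hj
    have hgA := hAbox j hj.le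
    have hgB := hBbox (j + 1) (by omega)
    have h2 : ℓ' * |gA j - gB (j + 1)| ≤ ℓ' * ((gA j) ^ 2 * gB (j + 1)) * disc gA gB j := by
      rw [mul_assoc]
      exact mul_le_mul_of_nonneg_left (abs_sub_le_of_inv_sq hgA.1 hgB.1) hℓ'
    linarith
  have h := twoPoint_fixedPoint_summable (δ := disc gA gB) (e := fun j => ℓ' * ((gA j) ^ 2 * gB (j + 1)))
    (U := ℓ' * U) (p := 0) (q := q)
    hρ1 hω hC hsmall ha le_rfl hq (disc_nonneg gA gB) hs he hU'
    (fun j i hij => hM j i hij.le) (disc_pin hpin) hback hfwd hwin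
  simp only [zero_add] at h
  exact h

/-- **NODE U2's OUTPUT FOR A β-FAMILY GENERATED BY A ONE-STEP SCHEME — AF FORM: THE STATEMENT OF
`T4FlagMemory.injectedRate_of_scheme` (lineage P1) WITH ITS LAST HYPOTHESIS `cr·ℓ′·((k₀+1)γ³ + 2γ/b) ≤ (1 − ρ)/2`
WEAKENED TO `cr·ℓ′·((k₀+1)γ³ + 2γ/b) ≤ (1 − (1 + C′)ω)/2`** (weaker by `afWindow_of_targetWindow`; independent of the
target rate `ρ`).  Every other hypothesis — `0 < γ`, `0 < b`, `(1 + C′)ω < ρ < 1`, `Represents Φ r γ β` (FULL β),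
`ReadLipschitz r cr`, `StepDirect Φ ℓ′ γ`, `StepMemory Φ M′` + `FadingMemory C′ ω M′`, `StepShift Φ γ src` with
`src k ≤ aρ^k`, the printed recursion (0.20) for every run of the family, the box, the pin, `EventualLowerH b γ k₀ β` —
and the conclusion `InjectedRate (2·cr·(a(ρ−ω)/(ρ−(1+C′)ω))/(1−ρ)) 0 ρ (disc …)` are P1's VERBATIM.  Proof: the join
(`T4FlagMemoryTwoRun.twoRunRenewal_of_scheme`), the AF weight sum (`T4CouplingMatching.sum_weights_le_of_eventualLower`)
and `disc_le_of_twoRun_af`.  Every analytic input is an UNPRINTED hypothesis shape; bookkeeping; NOT summit progress.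
[cite: Balaban1987RG1, (0.20) p.256 and Thm 2 p.259] -/
theorem injectedRate_of_fullScheme_twoRun_af {β : HBeta} {Φ : ℕ → ℝ → (ℕ → X) → X} {r : X → ℝ}
    {M' : ℕ → ℕ → ℝ} {src : ℕ → ℝ} {ℓ' C' ω γ cr a ρ b : ℝ} {k₀ : ℕ} (g : ℕ → ℕ → ℝ) (gIR : ℝ)
    (hγ : 0 < γ) (hb : 0 < b) (hρ1 : ρ < 1)
    (hℓ' : 0 ≤ ℓ') (hC' : 0 ≤ C') (hω : 0 ≤ ω) (hcr : 0 ≤ cr) (ha : 0 ≤ a) (hsmall : (1 + C') * ω < ρ)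
    (hrep : Represents Φ r γ β) (hr : ReadLipschitz r cr) (hdir : StepDirect Φ ℓ' γ)
    (hmem : StepMemory Φ M') (hM' : FadingMemory C' ω M') (hsh : StepShift Φ γ src)
    (hsrc : ∀ k, src k ≤ a * ρ ^ k)
    (hrun : ∀ K, RGEqH K β (g K)) (hbox : ∀ K i, i ≤ K → 0 < g K i ∧ g K i ≤ γ)
    (hpin : ∀ K, g K K = gIR) (hlo : EventualLowerH b γ k₀ β)
    (hwin : cr * ℓ' * (((k₀ : ℝ) + 1) * γ ^ 3 + 2 * γ / b) ≤ (1 - (1 + C') * ω) / 2) :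
    T4CauchySum.InjectedRate (2 * (cr * (a * (ρ - ω) / (ρ - (1 + C') * ω))) / (1 - ρ)) 0 ρ
      (fun K j => disc (g K) (g (K + 1)) j) := by
  intro K j hj
  refine ⟨disc_nonneg _ _ _, ?_⟩
  have hwin' : cr * (ℓ' * (((k₀ : ℝ) + 1) * γ ^ 3 + 2 * γ / b)) ≤ (1 - (1 + C') * ω) / 2 := by
    rw [← mul_assoc]; exact hwin
  have h := (disc_le_of_twoRun_af hρ1 hω hC' hsmall ha hℓ' hcr (hrun K) (hrun (K + 1)) (hbox K) (hbox (K + 1))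
    ((hpin K).trans (hpin (K + 1)).symm)
    (betaMismatch_le_of_represents hrep hr (hbox K) (hbox (K + 1)))
    (twoRunRenewal_of_scheme hdir hmem hsh hsrc (hbox K) (hbox (K + 1)))
    (fun j _ => pairDist_nonneg Φ (g K) (g (K + 1)) K j) hM'
    (sum_weights_le_of_eventualLower hγ hb (hrun K) (hrun (K + 1)) (hbox K) (hbox (K + 1)) hlo) hwin').1 j hj
  have h' : disc (g K) (g (K + 1)) j ≤ 2 * (cr * (a * (ρ - ω) / (ρ - (1 + C') * ω))) / (1 - ρ) * ρ ^ j :=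
    calc disc (g K) (g (K + 1)) j ≤ 2 * (cr * a * ((ρ - ω) / (ρ - (1 + C') * ω))) / (1 - ρ) * ρ ^ j := h
      _ = 2 * (cr * (a * (ρ - ω) / (ρ - (1 + C') * ω))) / (1 - ρ) * ρ ^ j := by ring
  simpa using h'

/-- **NODE U2's OUTPUT UNDER THE PRIMITIVE BOOKING — AF FORM.**  As `injectedRate_of_fullScheme_primitive` (ONE number
`ν < 1` dominating the source rate `θ` and the memory threshold `(1 + C′)ω`; rate `(1 + ν)/2`; constant
`8·cr·a/(1 − ν)²`), with the β-side AF inputs `0 < γ`, `0 < b`, `EventualLowerH b γ k₀ β` of P1 and the window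
`2·cr·ℓ′·((k₀+1)γ³ + 2γ/b) ≤ 1 − (1 + C′)ω` — which carries NO factor of `(1 − ν)` (contrast the sup-weight clause
`8·cr·ℓ′γ³ ≤ (1 − ν)²` of `injectedRate_of_fullScheme_primitive`, sharp without weight summability by §5).
(`injectedRate_of_fullScheme_twoRun_af` + `rateConst_le_primitive`.)  Bookkeeping over UNPRINTED inputs; NOT summit
progress. [cite: Balaban1987RG1, (0.20) p.256 and Thm 2 p.259] -/
theorem injectedRate_of_fullScheme_primitive_af {β : HBeta} {Φ : ℕ → ℝ → (ℕ → X) → X} {r : X → ℝ}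
    {M' : ℕ → ℕ → ℝ} {src : ℕ → ℝ} (g : ℕ → ℕ → ℝ) (gIR : ℝ) {ℓ' C' ω γ cr a θ ν b : ℝ} {k₀ : ℕ}
    (hγ : 0 < γ) (hb : 0 < b)
    (hℓ' : 0 ≤ ℓ') (hC' : 0 ≤ C') (hω : 0 ≤ ω) (hcr : 0 ≤ cr) (ha : 0 ≤ a) (hθ : 0 ≤ θ)
    (hν1 : ν < 1) (hθν : θ ≤ ν) (hCων : (1 + C') * ω ≤ ν)
    (hrep : Represents Φ r γ β) (hr : ReadLipschitz r cr) (hdir : StepDirect Φ ℓ' γ)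
    (hmem : StepMemory Φ M') (hM' : FadingMemory C' ω M') (hsh : StepShift Φ γ src)
    (hsrc : ∀ k, src k ≤ a * θ ^ k)
    (hrun : ∀ K, RGEqH K β (g K)) (hbox : ∀ K i, i ≤ K → 0 < g K i ∧ g K i ≤ γ)
    (hpin : ∀ K, g K K = gIR) (hlo : EventualLowerH b γ k₀ β)
    (hwin : 2 * (cr * ℓ' * (((k₀ : ℝ) + 1) * γ ^ 3 + 2 * γ / b)) ≤ 1 - (1 + C') * ω) :
    T4CauchySum.InjectedRate (8 * cr * a / (1 - ν) ^ 2) 0 ((1 + ν) / 2) (fun K j => disc (g K) (g (K + 1)) j) := by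
  have hgap : (1 + C') * ω < (1 + ν) / 2 := by linarith
  have hρ1 : (1 + ν) / 2 < 1 := by linarith
  have hρ0 : 0 ≤ (1 + ν) / 2 := by
    have : 0 ≤ (1 + C') * ω := mul_nonneg (by linarith) hω
    linarith
  have hsrc' : ∀ k, src k ≤ a * ((1 + ν) / 2) ^ k := fun k =>
    (hsrc k).trans (mul_le_mul_of_nonneg_left (pow_le_pow_left₀ hθ (by linarith) k) ha)
  have hwin' : cr * ℓ' * (((k₀ : ℝ) + 1) * γ ^ 3 + 2 * γ / b) ≤ (1 - (1 + C') * ω) / 2 := by linarith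
  exact injectedRate_mono_const
    (injectedRate_of_fullScheme_twoRun_af g gIR hγ hb hρ1 hℓ' hC' hω hcr ha hgap hrep hr hdir hmem hM' hsh hsrc'
      hrun hbox hpin hlo hwin')
    (rateConst_le_primitive hcr ha hC' hω hν1 hCων) hρ0

end Summable

end Literature.MathematicalPhysics.QuantumFieldTheory.Balaban1983to89.T4TwoRunClosure
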